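import Literature.Barriers.NavierStokesRegularity.NavierStokesInequalityCantorConvergence
import Literature.Barriers.NavierStokesRegularity.NavierStokesInequalityProfilesQ
import HarnessLib

/-!
# The profiles `q^{𝔪,k}_{i,t}` of Ożański's §6.3 ((6.20)) and the verification of Step 3

Barrier catalogue support file for `NavierStokesRegularity` (D-0021), on the discharge path of
fact D′ `Literature.Barriers.NavierStokesRegularity.NSICantorBlock_of_arrangement`
(`NavierStokesInequalityCantorArrangement`; W. S. Ożański, arXiv:1709.00602v4, §6.3; V. Scheffer,
Comm. Math. Phys. 110 (1987), Lemma 3.2). It is the `𝔐`-pair version of the tree's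
`NavierStokesInequalityProfilesQ` (the one-point (4.16) and §4.2): given finitely many pairs of
structures `(V_i^m, f_i^m, φ_i^m)` on `U_i^m` (`i ∈ {1,2}`, `m : A`), the data of Lemma 4.1 for
each of them (`δ`, the clamp `κ`, the profiles `H_i^m = h^m_{i,·}` with
`(H_i^m)² = (f_i^m)² - 2κ(t)δφ_i^m - limit`) and the new oscillatory processes `a_i^{m,k}`
(Theorem 17, `IsCantorOscFamily`), the profiles of (6.20),

  `(q^{m,k}_{i,t})² = (f_i^m)² - 2tδφ_i^m
      - ∫₀ᵗ a_i^{m,k}(s) v_i^m·(∇(h^m_{i,s})² + 2Σ_{l}Σ_{n} ∇p[a_l^{n,k}(s) v_l^n, h^n_{l,s}]) ds`,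

are built in the EXPANDED form (`∇p[bv,h] = ∇p[0,h] - b² F[v,h]`): the integrand is
`a_i^{m,k}(s)(g_i^m(s,x) + Σ_{l,n} a_l^{n,k}(s)² f_{i,l}^{m,n}(s,x))` with
`g_i^m = v_i^m·(∇(h_i^m)² + 2Σ_{l,n}∇p[0,h_l^n])` (`cgFam`) and `f_{i,l}^{m,n} = -2v_i^m·F[v_l^n,h_l^n]`
(`cfFam`). Then (Ożański §6.3 Steps 2–3, here in the tree's rendering with `C_i^m = {φ_i^m ≥ 1/4}`
and slack `δ/4`):

* `(q^{m,k}_{i,t})² - (h^m_{i,t})² = -coscError` for `t ∈ [0,T]`, uniformly small with two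
  derivatives for `k` large (`IsCantorOscFamily.coscError_small_two`, (6.21));
* `∂ₜ(q^{m,k}_{i,t})² = -2δφ_i^m - a_i^{m,k}(t) v_i^m·∇((h^m_{i,t})² + 2Σ_{l,n} p[a_l^{n,k}v_l^n, h^n_{l,t}])`
  ((6.20), differentiated);
* on `C_i^m`: the inner inequality (Case 2, (6.25)) with the error from the first lemma of
  Appendix A.3 (`exists_planePressure_sub_le`) and the `C²`-smallness, now summed over the
  `2·card A` pressure terms; off `C_i^m`: `v_i^m = 0`, `∂ₜ(q)² = -2δφ_i^m ≤ 0` and `q L(q) ≥ 0`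
  (Case 1; the perturbation criterion `DampedCriterion`);
* `q^{m,k}_{i,t} > |v_i^m|` on `U_i^m` for `t` in an open interval around `[0,T]` ("by continuity",
  tube lemma), smoothness there, `q^{m,k}_{i,0} = f_i^m`, `q = h` on `{φ_i^m < 1}`;
* `IsCantorQData.exists_cantorProfileData` — the assembled `IsNSICantorProfileData`, including the
  `C²`-closeness `|(q)² - (h)²|, ‖∇((q)² - (h)²)‖, ‖∇²((q)² - (h)²)‖ ≤ ε` at any prescribed tolerance
  `ε` (what Prop. 16 (ii), (6.22) and the `j`-uniform bounds of (iii)–(iv) consume).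

Indices `i ∈ Fin 2` (`0 ↦ 1`, `1 ↦ 2`), pairs `m : A` (a finite type; in §6.3 `A = {1,…,𝔐}`,
`𝔐 = Mʲ`).

## References

* W. S. Ożański, *On weak solutions to the Navier–Stokes inequality with internal
  singularities*, arXiv:1709.00602v4, §6.3 (Steps 2–3, (6.20)–(6.26)), §6.4 (Theorem 17),
  §4.1–4.2 and Appendix A.3. [`Ozanski2017NSISingular`]
* V. Scheffer, *Nearly one dimensional singularities of solutions to the Navier–Stokes
  inequality*, Comm. Math. Phys. 110 (1987), Lemma 3.2 ((3.14)–(3.41)). [`Scheffer1987`]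
-/

noncomputable section

open Set Function Filter Topology Metric MeasureTheory intervalIntegral
open scoped ContDiff

namespace Literature.Barriers.NavierStokesRegularity

open Literature.Analysis.FluidPDE

-- nested operator types `ℝ² →L[ℝ] ℝ² →L[ℝ] ℝ` (second derivatives)
set_option maxSynthPendingDepth 3

variable {A : Type*} [Fintype A]

/-! ### Finite families of constants -/

omit [Fintype A] in
/-- A positive constant below finitely many positive constants, for downward-closed properties
indexed by a finite type. [folklore] -/
theorem exists_pos_forall_fintype {ι : Type*} [Fintype ι] {P : ι → ℝ → Prop}
    (h : ∀ i, ∃ θ > 0, P i θ) (hmono : ∀ i θ θ', 0 < θ' → θ' ≤ θ → P i θ → P i θ') :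
    ∃ θ > 0, ∀ i, P i θ := by
  choose θ hθ hP using h
  rcases isEmpty_or_nonempty ι with hι | hι
  · exact ⟨1, one_pos, fun i => (IsEmpty.false i).elim⟩
  · have hne : (Finset.univ : Finset ι).Nonempty := Finset.univ_nonempty
    refine ⟨Finset.univ.inf' hne θ, (Finset.lt_inf'_iff hne).2 fun i _ => hθ i, fun i => ?_⟩
    exact hmono i (θ i) _ ((Finset.lt_inf'_iff hne).2 fun i _ => hθ i)
      (Finset.inf'_le θ (Finset.mem_univ i)) (hP i)

omit [Fintype A] in
/-- A nonnegative constant above finitely many nonnegative constants, for upward-closed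
properties indexed by a finite type. [folklore] -/
theorem exists_nonneg_forall_fintype {ι : Type*} [Fintype ι] {P : ι → ℝ → Prop}
    (h : ∀ i, ∃ B, 0 ≤ B ∧ P i B) (hmono : ∀ i B B', B ≤ B' → P i B → P i B') :
    ∃ B, 0 ≤ B ∧ ∀ i, P i B := by
  choose B hB hP using h
  refine ⟨∑ i, B i, Finset.sum_nonneg fun i _ => hB i, fun i => hmono i (B i) _ ?_ (hP i)⟩
  exact Finset.single_le_sum (f := B) (fun i _ => hB i) (Finset.mem_univ i)

/-! ### The expanded families of (6.20) -/

/-- **`g_i^m(s,x) = v_i^m·∇(h^m_{i,s})² + 2Σ_lΣ_n v_i^m·∇p[0,h^n_{l,s}]`** — the direction-independent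
part of the integrand of (6.20) (after `∇p[bv,h] = ∇p[0,h] - b²F[v,h]`).
[cite: Ozanski2017NSISingular, §6.3 (6.20)] -/
def cgFam (V : Fin 2 → A → ℝ × ℝ → ℝ × ℝ) (H : Fin 2 → A → ℝ → ℝ × ℝ → ℝ) :
    Fin 2 → A → ℝ → ℝ × ℝ → ℝ :=
  fun i m s x =>
    (V i m x).1 * derivR (fun y => H i m s y ^ 2) x + (V i m x).2 * derivZ (fun y => H i m s y ^ 2) x +
      2 * ∑ l, ∑ n, ((V i m x).1 * derivR (planePressure 0 (H l n s)) x +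
        (V i m x).2 * derivZ (planePressure 0 (H l n s)) x)

/-- **`f_{i,l}^{m,n}(s,x) = -2v_i^m·F[v_l^n,h^n_{l,s}]`** — the coefficient of `a_l^{n,k}(s)²` in the
integrand of (6.20) (`F_{i,l}^{m,n}(x,s,b) = b² f_{i,l}^{m,n}(s,x)`;
`½(F_{2,1}^{m,m}(1) - F_{2,1}^{m,m}(0)) = -v_2^m·F[v_1^m,h_1^m]`, (6.27) versus (6.11)).
[cite: Ozanski2017NSISingular, §6.3 (6.20) and §6.4 (6.27)] -/
def cfFam (V : Fin 2 → A → ℝ × ℝ → ℝ × ℝ) (H : Fin 2 → A → ℝ → ℝ × ℝ → ℝ) :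
    Fin 2 → Fin 2 → A → A → ℝ → ℝ × ℝ → ℝ :=
  fun i l m n s x =>
    -2 * ((V i m x).1 * (pressureInteraction (V l n) (H l n s) x).1 +
      (V i m x).2 * (pressureInteraction (V l n) (H l n s) x).2)

/-- **The radicand `(q^{m,k}_{i,t})²` of (6.20)**: `(f_i^m)² - 2κ(t)δφ_i^m - coscIntegral` (time
clamped as for `h`; `κ = id` on `[0,T]`). [cite: Ozanski2017NSISingular, §6.3 (6.20)] -/
def cqRad (f φ : Fin 2 → A → ℝ × ℝ → ℝ) (δ : ℝ) (κ : ℝ → ℝ) (a : ℕ → Fin 2 → A → ℝ → ℝ)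
    (V : Fin 2 → A → ℝ × ℝ → ℝ × ℝ) (H : Fin 2 → A → ℝ → ℝ × ℝ → ℝ) (k : ℕ) (i : Fin 2) (m : A)
    (t : ℝ) (x : ℝ × ℝ) : ℝ :=
  f i m x ^ 2 - 2 * κ t * δ * φ i m x - coscIntegral a (cgFam V H) (cfFam V H) k i m t x

/-- **`q^{m,k}_{i,t} = √((q^{m,k}_{i,t})²)`** ((6.20)). [cite: Ozanski2017NSISingular, §6.3 (6.20)] -/
def cqProf (f φ : Fin 2 → A → ℝ × ℝ → ℝ) (δ : ℝ) (κ : ℝ → ℝ) (a : ℕ → Fin 2 → A → ℝ → ℝ)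
    (V : Fin 2 → A → ℝ × ℝ → ℝ × ℝ) (H : Fin 2 → A → ℝ → ℝ × ℝ → ℝ) (k : ℕ) (i : Fin 2) (m : A)
    (t : ℝ) (x : ℝ × ℝ) : ℝ :=
  Real.sqrt (cqRad f φ δ κ a V H k i m t x)

/-- **The planar potential of the composite field**
`Φ_i^m(t) = Q_i^m(t)² + 2Σ_lΣ_n p[B_l^n(t) V_l^n, Q_l^n(t)]` whose planar gradient, paired with
`B_i^m(t) V_i^m`, is the transport term of the Navier–Stokes inequality on the meridian half-plane
near `U_i^m` (Ożański §6.3 Step 3, (6.24): `p̄(x,0,t) = Σ_𝔫 (p[a_1^{𝔫,k}v_1^𝔫,q_1^{𝔫,k}] +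
p[a_2^{𝔫,k}v_2^𝔫,q_2^{𝔫,k}])`, Case 2). [cite: Ozanski2017NSISingular, §6.3 (6.24) and Case 2] -/
def cprofilePotential (V : Fin 2 → A → ℝ × ℝ → ℝ × ℝ) (B : Fin 2 → A → ℝ → ℝ)
    (Q : Fin 2 → A → ℝ → ℝ × ℝ → ℝ) (i : Fin 2) (m : A) (t : ℝ) (q : ℝ × ℝ) : ℝ :=
  Q i m t q ^ 2 + 2 * ∑ l, ∑ n, planePressure (B l n t • V l n) (Q l n t) q

/-! ### The hypotheses: Lemma 4.1 data on every pair and the new oscillatory processes -/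

/-- **The input of §6.3 Steps 2–3**: the `2·card A` structures `(V_i^m, f_i^m, φ_i^m)` on `U_i^m`;
the slack `δ > 0` and the clamp `κ` of Lemma 4.1; gaps and perturbation criteria on `[-1,T+1]`;
the profiles `H_i^m = h^m_{i,·}` jointly smooth, giving structures `(bV_i^m, H^m_{i,t}, ψ_i^m)` for
all `t`, `|b| ≤ 1`, with squares `(H^m_{i,t})² = (f_i^m)² - 2κ(t)δφ_i^m - coscLimit(f)_i^m(κ t)`
((6.10)–(6.11): `coscLimit` is `-∫₀ᵗ v_2^m·F[v_1^m,h_1^m]` for `i = 2`, `0` for `i = 1`); and a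
family of new oscillatory processes `a` (Theorem 17).
[cite: Ozanski2017NSISingular, §6.3 Steps 1–2 and Lemma 4.1] -/
structure IsCantorQData (U : Fin 2 → A → Set (ℝ × ℝ)) (V : Fin 2 → A → ℝ × ℝ → ℝ × ℝ)
    (f φ ψ : Fin 2 → A → ℝ × ℝ → ℝ) (H : Fin 2 → A → ℝ → ℝ × ℝ → ℝ) (T δ : ℝ) (κ : ℝ → ℝ)
    (a : ℕ → Fin 2 → A → ℝ → ℝ) : Prop where
  /-- The structures. -/
  isNSIStructure : ∀ i m, IsNSIStructure (U i m) (V i m) (f i m) (φ i m)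
  /-- `δ > 0`. -/
  δ_pos : 0 < δ
  /-- `T > 0`. -/
  T_pos : 0 < T
  /-- The clamp is smooth, -/
  κ_smooth : ContDiff ℝ ∞ κ
  /-- the identity on `[0,T]`, -/
  κ_eq : ∀ t ∈ Icc (0 : ℝ) T, κ t = t
  /-- with derivative `1` there, -/
  deriv_κ_eq : ∀ t ∈ Icc (0 : ℝ) T, deriv κ t = 1
  /-- and range in `[-1, T+1]`. -/
  κ_mem : ∀ t, κ t ∈ Icc (-1 : ℝ) (T + 1)
  /-- The gaps on `supp φ_i^m`. -/
  gap : ∀ i m, ∃ μ > 0, ∀ t ∈ Icc (-1 : ℝ) (T + 1), ∀ x ∈ tsupport (φ i m),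
    (V i m x).1 ^ 2 + (V i m x).2 ^ 2 + μ ≤ f i m x ^ 2 - 2 * t * δ * φ i m x
  /-- The perturbation criteria. -/
  crit : ∀ i m, DampedCriterion (U i m) (V i m) (f i m) (φ i m) (ψ i m) δ T
  /-- `H_i^m` is jointly smooth. -/
  H_smooth : ∀ i m, ContDiff ℝ ∞ (uncurry (H i m))
  /-- `(bV_i^m, H^m_{i,t}, ψ_i^m)` is a structure on `U_i^m`. -/
  H_str : ∀ i m t, ∀ b : ℝ, |b| ≤ 1 → IsNSIStructure (U i m) (b • V i m) (H i m t) (ψ i m)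
  /-- (6.10)–(6.11): `(H^m_{i,t})² = (f_i^m)² - 2κ(t)δφ_i^m - coscLimit(f)_i^m(κ t)`. -/
  H_sq : ∀ i m t x, H i m t x ^ 2 =
    f i m x ^ 2 - 2 * κ t * δ * φ i m x - coscLimit (cfFam V H) i m (κ t) x
  /-- The new oscillatory processes (Theorem 17). -/
  osc : IsCantorOscFamily A T a

/-! ### The output: profile data for the composite field (Scheffer 1987, Lemma 3.2, (3.14)–(3.24)) -/

/-- **Profile data for the composite field of Proposition 16** — the `𝔐`-pair version of
`IsNSIProfileData` (Scheffer 1987, the hypotheses (3.14)–(3.24) of Lemma 3.2 with smooth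
time-dependent directions `|a| ≤ 1`, (3.23); Ożański 2017, §6.3 Step 3): a margin `η > 0`
(`J = (-η, T+η)`), a slack `δ > 0`, closed sets `C_i^m ⊆ U_i^m` containing `supp v_i^m`, directions
`B_i^m ∈ C^∞(ℝ;[-1,1])` and profiles `Q_i^m : J × ℝ² → [0,∞)` jointly smooth, vanishing off
`Ū_i^m`, with `Q_i^m(t) > |v_i^m|` in `U_i^m` and `Q_i^m(0) = f_i^m`, such that for `t ∈ [0,T]`:
on `C_i^m` the inner inequality with slack
`∂ₜ(Q_i^m)² ≤ -δ - B_i^m v_i^m·∇((Q_i^m)² + 2Σ_{l,n} p[B_l^n v_l^n, Q_l^n])` (Case 2 of Step 3),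
off `C_i^m` `∂ₜ(Q_i^m)² ≤ 0` and `Q_i^m L(Q_i^m) ≥ 0` (Case 1); together with what Prop. 16 (ii)
and the `j`-uniform bounds consume: `Q_i^m = H_i^m` on `{φ_i^m < 1}` and the `C²`-closeness
`|(Q_i^m)² - (H_i^m)²| ≤ ε`, `‖∇(…)‖ ≤ ε`, `‖∇²(…)‖ ≤ ε` on `[0,T] × ℝ²` ((6.21)–(6.22)).
[cite: Scheffer1987, Lemma 3.2 (3.14)–(3.24)] [cite: Ozanski2017NSISingular, §6.3 Steps 2–3] -/
structure IsNSICantorProfileData (U : Fin 2 → A → Set (ℝ × ℝ)) (V : Fin 2 → A → ℝ × ℝ → ℝ × ℝ)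
    (f φ : Fin 2 → A → ℝ × ℝ → ℝ) (H : Fin 2 → A → ℝ → ℝ × ℝ → ℝ) (T η δ ε : ℝ)
    (C : Fin 2 → A → Set (ℝ × ℝ)) (B : Fin 2 → A → ℝ → ℝ) (Q : Fin 2 → A → ℝ → ℝ × ℝ → ℝ) :
    Prop where
  /-- The time margin is positive. -/
  η_pos : 0 < η
  /-- The slack is positive. -/
  δ_pos : 0 < δ
  /-- The directions are smooth … -/
  B_smooth : ∀ i m, ContDiff ℝ ∞ (B i m)
  /-- … and bounded by one. -/
  abs_B_le : ∀ i m t, |B i m t| ≤ 1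
  /-- `C_i^m` is closed, -/
  isClosed : ∀ i m, IsClosed (C i m)
  /-- `C_i^m ⊆ U_i^m`, -/
  subset : ∀ i m, C i m ⊆ U i m
  /-- `supp v_i^m ⊆ C_i^m`. -/
  tsupport_V : ∀ i m, tsupport (V i m) ⊆ C i m
  /-- `Q_i^m` is jointly smooth on `J × ℝ²`. -/
  Q_smooth : ∀ i m, ContDiffOn ℝ ∞ (uncurry (Q i m)) (Ioo (-η) (T + η) ×ˢ univ)
  /-- `Q_i^m ≥ 0`. -/
  Q_nonneg : ∀ i m, ∀ t ∈ Ioo (-η) (T + η), ∀ q, 0 ≤ Q i m t q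
  /-- `Q_i^m(t) = 0` off `Ū_i^m`. -/
  Q_eq_zero : ∀ i m, ∀ t ∈ Ioo (-η) (T + η), ∀ q ∉ closure (U i m), Q i m t q = 0
  /-- `Q_i^m(t) > |v_i^m|` in `U_i^m`. -/
  sq_lt : ∀ i m, ∀ t ∈ Ioo (-η) (T + η), ∀ q ∈ U i m,
    (V i m q).1 ^ 2 + (V i m q).2 ^ 2 < Q i m t q ^ 2
  /-- `Q_i^m(0) = f_i^m`. -/
  initial : ∀ i m q, Q i m 0 q = f i m q
  /-- `Q_i^m(t) = H_i^m(t)` on `{φ_i^m < 1}` (all `t`). -/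
  eq_H : ∀ i m t q, φ i m q < 1 → Q i m t q = H i m t q
  /-- On `C_i^m`, `t ∈ [0,T]`: the inner inequality with slack (Case 2 of Step 3). -/
  inner : ∀ i m, ∀ t ∈ Icc (0 : ℝ) T, ∀ q ∈ C i m, deriv (fun s => Q i m s q ^ 2) t ≤
    -δ - (B i m t * (V i m q).1 * derivR (cprofilePotential V B Q i m t) q +
      B i m t * (V i m q).2 * derivZ (cprofilePotential V B Q i m t) q)
  /-- Off `C_i^m`, `t ∈ [0,T]`: `∂ₜ(Q_i^m)² ≤ 0` (Case 1). -/
  outer : ∀ i m, ∀ t ∈ Icc (0 : ℝ) T, ∀ q ∉ C i m, deriv (fun s => Q i m s q ^ 2) t ≤ 0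
  /-- Off `C_i^m` in `P`, `t ∈ [0,T]`: `Q_i^m L(Q_i^m) ≥ 0`. -/
  opL : ∀ i m, ∀ t ∈ Icc (0 : ℝ) T, ∀ q ∉ C i m, 0 < q.1 → 0 ≤ Q i m t q * opL (Q i m t) q
  /-- The tolerance is nonnegative. -/
  ε_nonneg : 0 ≤ ε
  /-- (6.22): `|(Q_i^m)² - (H_i^m)²| ≤ ε` on `[0,T] × ℝ²`. -/
  close₀ : ∀ i m, ∀ t ∈ Icc (0 : ℝ) T, ∀ q, |Q i m t q ^ 2 - H i m t q ^ 2| ≤ ε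
  /-- (6.21), first order: `‖∇((Q_i^m)² - (H_i^m)²)‖ ≤ ε`. -/
  close₁ : ∀ i m, ∀ t ∈ Icc (0 : ℝ) T, ∀ q,
    ‖fderiv ℝ (fun y => Q i m t y ^ 2 - H i m t y ^ 2) q‖ ≤ ε
  /-- (6.21), second order: `‖∇²((Q_i^m)² - (H_i^m)²)‖ ≤ ε`. -/
  close₂ : ∀ i m, ∀ t ∈ Icc (0 : ℝ) T, ∀ q,
    ‖fderiv ℝ (fderiv ℝ fun y => Q i m t y ^ 2 - H i m t y ^ 2) q‖ ≤ ε

namespace IsCantorQData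

variable {U : Fin 2 → A → Set (ℝ × ℝ)} {V : Fin 2 → A → ℝ × ℝ → ℝ × ℝ}
  {f φ ψ : Fin 2 → A → ℝ × ℝ → ℝ} {H : Fin 2 → A → ℝ → ℝ × ℝ → ℝ} {T δ : ℝ} {κ : ℝ → ℝ}
  {a : ℕ → Fin 2 → A → ℝ → ℝ}

/-! ### Basic consequences -/

/-- `(V_i^m, H^m_{i,t}, ψ_i^m)` is a structure. [cite: Ozanski2017NSISingular, §6.3 Step 1] -/
theorem H_str_one (hQ : IsCantorQData U V f φ ψ H T δ κ a) (i : Fin 2) (m : A) (t : ℝ) :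
    IsNSIStructure (U i m) (V i m) (H i m t) (ψ i m) := by
  simpa using hQ.H_str i m t 1 (by norm_num)

/-- `(0, H^m_{i,t}, ψ_i^m)` is a structure. [cite: Ozanski2017NSISingular, §6.3 Step 1] -/
theorem H_str_zero (hQ : IsCantorQData U V f φ ψ H T δ κ a) (i : Fin 2) (m : A) (t : ℝ) :
    IsNSIStructure (U i m) 0 (H i m t) (ψ i m) := by
  simpa using hQ.H_str i m t 0 (by norm_num)

/-- `V_i^m = 0` on `{φ_i^m < 1}`. [cite: Ozanski2017NSISingular, Definition 3.3] -/
theorem V_eq_zero_of_lt (hQ : IsCantorQData U V f φ ψ H T δ κ a) {i : Fin 2} {m : A} {x : ℝ × ℝ}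
    (hx : φ i m x < 1) : V i m x = 0 :=
  (hQ.isNSIStructure i m).v_eq_zero_of_lt hx

/-- `V_i^m = 0` off `supp φ_i^m`. [folklore] -/
theorem V_eq_zero_of_notMem (hQ : IsCantorQData U V f φ ψ H T δ κ a) {i : Fin 2} {m : A}
    {x : ℝ × ℝ} (hx : x ∉ tsupport (φ i m)) : V i m x = 0 :=
  hQ.V_eq_zero_of_lt (by rw [image_eq_zero_of_notMem_tsupport hx]; norm_num)

/-- The compact parameter set `P = ⋃_{i,m} Ū_i^m`. [cite: Ozanski2017NSISingular, §6.4 (Theorem 17: "uniformly in `(x,t) ∈ P × [0,T]`")] -/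
theorem isCompact_P (hQ : IsCantorQData U V f φ ψ H T δ κ a) :
    IsCompact (⋃ i, ⋃ m, closure (U i m)) :=
  isCompact_iUnion fun i => isCompact_iUnion fun m => (hQ.isNSIStructure i m).isCompact_closure

/-- Off `P` all planar fields vanish. [folklore] -/
theorem V_eq_zero_of_notMem_P (hQ : IsCantorQData U V f φ ψ H T δ κ a) {x : ℝ × ℝ}
    (hx : x ∉ ⋃ i, ⋃ m, closure (U i m)) (i : Fin 2) (m : A) : V i m x = 0 :=
  (hQ.isNSIStructure i m).v_eq_zero fun h => hx (mem_iUnion.2 ⟨i, mem_iUnion.2 ⟨m, h⟩⟩)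

/-! ### Smoothness of the families -/

/-- `(s,y) ↦ (H^m_{i,s})²(y)` is jointly smooth. [folklore] -/
theorem contDiff_H_sq (hQ : IsCantorQData U V f φ ψ H T δ κ a) (i : Fin 2) (m : A) :
    ContDiff ℝ ∞ (uncurry fun (s : ℝ) (y : ℝ × ℝ) => H i m s y ^ 2) :=
  (hQ.H_smooth i m).pow 2

/-- `(s,x) ↦ ∂ᵣ p[0,H^n_{l,s}](x)` is jointly smooth. [cite: Ozanski2017NSISingular, §6.3 (6.20) and (3.21)] -/
theorem contDiff_derivR_planePressure_zero (hQ : IsCantorQData U V f φ ψ H T δ κ a) (l : Fin 2)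
    (n : A) : ContDiff ℝ ∞ fun p : ℝ × (ℝ × ℝ) => derivR (planePressure 0 (H l n p.1)) p.2 := by
  have h := contDiff_derivR_planePressure_family (hQ.isNSIStructure l n) (b := 0) (by norm_num)
    (hQ.H_smooth l n) (fun t q => (hQ.H_str_one l n t).f_nonneg q)
    (fun t _ hq => (hQ.H_str_one l n t).f_eq_zero hq) (fun t q hq => (hQ.H_str_one l n t).sq_lt q hq)
  simpa using h

/-- `(s,x) ↦ ∂_z p[0,H^n_{l,s}](x)` is jointly smooth. [cite: Ozanski2017NSISingular, §6.3 (6.20) and (3.21)] -/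
theorem contDiff_derivZ_planePressure_zero (hQ : IsCantorQData U V f φ ψ H T δ κ a) (l : Fin 2)
    (n : A) : ContDiff ℝ ∞ fun p : ℝ × (ℝ × ℝ) => derivZ (planePressure 0 (H l n p.1)) p.2 := by
  have h := contDiff_derivZ_planePressure_family (hQ.isNSIStructure l n) (b := 0) (by norm_num)
    (hQ.H_smooth l n) (fun t q => (hQ.H_str_one l n t).f_nonneg q)
    (fun t _ hq => (hQ.H_str_one l n t).f_eq_zero hq) (fun t q hq => (hQ.H_str_one l n t).sq_lt q hq)
  simpa using h

/-- `(s,x) ↦ F[V_l^n, H^n_{l,s}](x)` is jointly smooth. [cite: Ozanski2017NSISingular, §3.6 (3.34) and §6.3] -/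
theorem contDiff_pressureInteraction (hQ : IsCantorQData U V f φ ψ H T δ κ a) (l : Fin 2) (n : A) :
    ContDiff ℝ ∞ fun p : ℝ × (ℝ × ℝ) => pressureInteraction (V l n) (H l n p.1) p.2 :=
  contDiff_pressureInteraction_family (hQ.isNSIStructure l n) (hQ.H_smooth l n)
    (fun t q => (hQ.H_str_one l n t).f_nonneg q) (fun t _ hq => (hQ.H_str_one l n t).f_eq_zero hq)
    (fun t q hq => (hQ.H_str_one l n t).sq_lt q hq)

/-- **`g_i^m` is jointly smooth in `(s,x)`.** [cite: Ozanski2017NSISingular, §6.3 Step 2] -/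
theorem contDiff_cgFam (hQ : IsCantorQData U V f φ ψ H T δ κ a) (i : Fin 2) (m : A) :
    ContDiff ℝ ∞ (uncurry (cgFam V H i m)) := by
  have hv : ContDiff ℝ ∞ fun p : ℝ × (ℝ × ℝ) => V i m p.2 :=
    (hQ.isNSIStructure i m).v_smooth.comp contDiff_snd
  have hv1 := contDiff_fst.comp hv
  have hv2 := contDiff_snd.comp hv
  have hR := (hQ.contDiff_H_sq i m).derivR_param (P := fun s y => H i m s y ^ 2)
  have hZ := (hQ.contDiff_H_sq i m).derivZ_param (P := fun s y => H i m s y ^ 2)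
  have hS : ContDiff ℝ ∞ fun p : ℝ × (ℝ × ℝ) => ∑ l, ∑ n,
      ((V i m p.2).1 * derivR (planePressure 0 (H l n p.1)) p.2 +
        (V i m p.2).2 * derivZ (planePressure 0 (H l n p.1)) p.2) :=
    ContDiff.sum fun l _ => ContDiff.sum fun n _ =>
      (hv1.mul (hQ.contDiff_derivR_planePressure_zero l n)).add
        (hv2.mul (hQ.contDiff_derivZ_planePressure_zero l n))
  exact ((hv1.mul hR).add (hv2.mul hZ)).add (contDiff_const.mul hS)

/-- **`f_{i,l}^{m,n}` is jointly smooth in `(s,x)`.** [cite: Ozanski2017NSISingular, §6.3 Step 2] -/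
theorem contDiff_cfFam (hQ : IsCantorQData U V f φ ψ H T δ κ a) (i l : Fin 2) (m n : A) :
    ContDiff ℝ ∞ (uncurry (cfFam V H i l m n)) := by
  have hv : ContDiff ℝ ∞ fun p : ℝ × (ℝ × ℝ) => V i m p.2 :=
    (hQ.isNSIStructure i m).v_smooth.comp contDiff_snd
  have hF := hQ.contDiff_pressureInteraction l n
  exact contDiff_const.mul (((contDiff_fst.comp hv).mul (contDiff_fst.comp hF)).add
    ((contDiff_snd.comp hv).mul (contDiff_snd.comp hF)))

/-! ### Vanishing where `V_i^m = 0` -/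

omit [Fintype A] in
/-- `g_i^m(s,x) = 0` where `V_i^m(x) = 0`. [folklore] -/
theorem cgFam_eq_zero [Fintype A] {i : Fin 2} {m : A} {x : ℝ × ℝ} (hx : V i m x = 0) (s : ℝ) :
    cgFam V H i m s x = 0 := by
  simp [cgFam, hx]

omit [Fintype A] in
/-- `f_{i,l}^{m,n}(s,x) = 0` where `V_i^m(x) = 0`. [folklore] -/
theorem cfFam_eq_zero {i : Fin 2} (l : Fin 2) {m : A} (n : A) {x : ℝ × ℝ} (hx : V i m x = 0)
    (s : ℝ) : cfFam V H i l m n s x = 0 := by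
  simp [cfFam, hx]

/-- The oscillatory integral vanishes where `V_i^m = 0`. [folklore] -/
theorem coscIntegral_eq_zero {i : Fin 2} {m : A} {x : ℝ × ℝ} (hx : V i m x = 0) (k : ℕ) (t : ℝ) :
    coscIntegral a (cgFam V H) (cfFam V H) k i m t x = 0 := by
  simp [coscIntegral, cgFam_eq_zero hx, cfFam_eq_zero _ _ hx]

omit [Fintype A] in
/-- The limit vanishes where `V_i^m = 0`. [folklore] -/
theorem coscLimit_eq_zero {i : Fin 2} {m : A} {x : ℝ × ℝ} (hx : V i m x = 0) (t : ℝ) :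
    coscLimit (cfFam V H) i m t x = 0 := by
  by_cases hi : i = 1
  · subst hi; simp [coscLimit, cfFam_eq_zero _ _ hx]
  · simp [coscLimit, hi]

/-- The error vanishes where `V_i^m = 0`. [folklore] -/
theorem coscError_eq_zero {i : Fin 2} {m : A} {x : ℝ × ℝ} (hx : V i m x = 0) (k : ℕ) (t : ℝ) :
    coscError a (cgFam V H) (cfFam V H) k i m t x = 0 := by
  rw [coscError, coscIntegral_eq_zero hx, coscLimit_eq_zero hx, sub_zero]

/-- Where `V_i^m = 0` the radicand is the damped radicand `(f_i^m)² - 2κ(t)δφ_i^m`.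
[cite: Ozanski2017NSISingular, §6.3 Step 2] -/
theorem cqRad_of_V_eq_zero {i : Fin 2} {m : A} {x : ℝ × ℝ} (hx : V i m x = 0) (k : ℕ) (t : ℝ) :
    cqRad f φ δ κ a V H k i m t x = f i m x ^ 2 - 2 * κ t * δ * φ i m x := by
  rw [cqRad, coscIntegral_eq_zero hx, sub_zero]

/-- **(6.20) versus (6.10)–(6.11): `(q^{m,k}_{i,t})² - (H^m_{i,t})² = -coscError` at times with
`κ(t) = t`.** [cite: Ozanski2017NSISingular, §6.3 (6.20)] -/
theorem cqRad_sub_H_sq (hQ : IsCantorQData U V f φ ψ H T δ κ a) (k : ℕ) (i : Fin 2) (m : A)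
    {t : ℝ} (ht : κ t = t) (x : ℝ × ℝ) :
    cqRad f φ δ κ a V H k i m t x - H i m t x ^ 2 =
      -coscError a (cgFam V H) (cfFam V H) k i m t x := by
  rw [cqRad, hQ.H_sq i m t x, ht, coscError]
  ring

/-- **`H^m_{i,t} = √((f_i^m)² - 2κ(t)δφ_i^m)` on `{φ_i^m < 1}`** (the limit vanishes there).
[cite: Ozanski2017NSISingular, §6.3 Step 2] -/
theorem H_eq_dampedProfile (hQ : IsCantorQData U V f φ ψ H T δ κ a) (i : Fin 2) (m : A) (t : ℝ)
    {x : ℝ × ℝ} (hx : φ i m x < 1) : H i m t x = dampedProfile (f i m) (φ i m) δ (κ t) x := by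
  have h1 := hQ.H_sq i m t x
  rw [coscLimit_eq_zero (hQ.V_eq_zero_of_lt hx), sub_zero] at h1
  have h0 : 0 ≤ H i m t x := (hQ.H_str_one i m t).f_nonneg x
  rw [dampedProfile_apply, ← h1, Real.sqrt_sq h0]

/-! ### The link with the planar potential ((6.20) and Case 2 of Step 3) -/

omit [Fintype A] in
/-- Regrouping a double sum of planar pairings (pure algebra). [folklore] -/
theorem sum_sum_comb [Fintype A] (w1 w2 : ℝ) (r z f1 f2 b : Fin 2 → A → ℝ) :
    ∑ l, ∑ n, ((w1 * r l n + w2 * z l n) - b l n * (w1 * f1 l n + w2 * f2 l n)) =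
      w1 * ∑ l, ∑ n, (r l n - b l n * f1 l n) + w2 * ∑ l, ∑ n, (z l n - b l n * f2 l n) := by
  rw [Finset.mul_sum, Finset.mul_sum, ← Finset.sum_add_distrib]
  refine Finset.sum_congr rfl fun l _ => ?_
  rw [Finset.mul_sum, Finset.mul_sum, ← Finset.sum_add_distrib]
  refine Finset.sum_congr rfl fun n _ => ?_
  ring

omit [Fintype A] in
/-- A double sum of differences is the difference of the double sums. [folklore] -/
theorem sum_sum_sub [Fintype A] (P G : Fin 2 → A → ℝ) :
    ∑ l, ∑ n, (P l n - G l n) = ∑ l, ∑ n, P l n - ∑ l, ∑ n, G l n := by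
  simp only [Finset.sum_sub_distrib]

omit [Fintype A] in
/-- Constants come out of double sums. [folklore] -/
theorem sum_sum_mul [Fintype A] (c : ℝ) (G : Fin 2 → A → ℝ) :
    ∑ l, ∑ n, c * G l n = c * ∑ l, ∑ n, G l n := by
  simp only [Finset.mul_sum]

/-- **Expansion of the transport pairing**: for profiles `Q_l^n` giving structures
`(bV_l^n, Q^n_{l,s}, ψ_l^n)` and directions `|B_l^n(s)| ≤ 1`,
`V_i^m·∇(Q_i^m² + 2Σ_{l,n} p[B_l^nV_l^n,Q_l^n])(x)
  = V_i^m·∇(Q_i^m)²(x) + 2Σ_{l,n} (V_i^m·∇p[0,Q_l^n](x) - (B_l^n)² V_i^m·F[V_l^n,Q_l^n](x))`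
(sum rule and `∇p[bv,h] = ∇p[0,h] - b²F[v,h]`). [cite: Ozanski2017NSISingular, §6.3 (6.24)–(6.25) and Lemma 3.2 (i)] -/
theorem inner_grad_cprofilePotential {Q : Fin 2 → A → ℝ → ℝ × ℝ → ℝ} {B : Fin 2 → A → ℝ → ℝ}
    (s : ℝ) (hQs : ∀ l n, ContDiff ℝ ∞ (Q l n s))
    (hQstr : ∀ l n, ∀ b : ℝ, |b| ≤ 1 → IsNSIStructure (U l n) (b • V l n) (Q l n s) (ψ l n))
    (hB : ∀ l n, |B l n s| ≤ 1) (i : Fin 2) (m : A) (x : ℝ × ℝ) :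
    (V i m x).1 * derivR (cprofilePotential V B Q i m s) x +
        (V i m x).2 * derivZ (cprofilePotential V B Q i m s) x =
      (V i m x).1 * derivR (fun y => Q i m s y ^ 2) x + (V i m x).2 * derivZ (fun y => Q i m s y ^ 2) x +
        2 * ∑ l, ∑ n, (((V i m x).1 * derivR (planePressure 0 (Q l n s)) x +
              (V i m x).2 * derivZ (planePressure 0 (Q l n s)) x) -
            B l n s ^ 2 * ((V i m x).1 * (pressureInteraction (V l n) (Q l n s) x).1 +
              (V i m x).2 * (pressureInteraction (V l n) (Q l n s) x).2)) := by
  have h1 : ∀ l n, IsNSIStructure (U l n) (V l n) (Q l n s) (ψ l n) := fun l n => by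
    simpa using hQstr l n 1 (by norm_num)
  -- differentiability of the summands
  have hdq : DifferentiableAt ℝ (fun y => Q i m s y ^ 2) x :=
    (((hQs i m).pow 2).differentiable (by simp)) x
  have hdp : ∀ l n, DifferentiableAt ℝ (planePressure (B l n s • V l n) (Q l n s)) x := fun l n =>
    ((hQstr l n (B l n s) (hB l n)).contDiff_planePressure.differentiable (by simp)) x
  have hdS : HasFDerivAt (fun y => ∑ l, ∑ n, planePressure (B l n s • V l n) (Q l n s) y)
      (∑ l, ∑ n, fderiv ℝ (planePressure (B l n s • V l n) (Q l n s)) x) x :=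
    HasFDerivAt.fun_sum fun l _ => HasFDerivAt.fun_sum fun n _ => (hdp l n).hasFDerivAt
  have hd : HasFDerivAt (cprofilePotential V B Q i m s)
      (fderiv ℝ (fun y => Q i m s y ^ 2) x +
        (2 : ℝ) • ∑ l, ∑ n, fderiv ℝ (planePressure (B l n s • V l n) (Q l n s)) x) x :=
    hdq.hasFDerivAt.add (hdS.const_mul (2 : ℝ))
  have eR : derivR (cprofilePotential V B Q i m s) x = derivR (fun y => Q i m s y ^ 2) x +
      2 * ∑ l, ∑ n, derivR (planePressure (B l n s • V l n) (Q l n s)) x := by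
    simp only [derivR, hd.fderiv, _root_.add_apply, FunLike.coe_smul, Pi.smul_apply, smul_eq_mul,
      _root_.sum_apply]
  have eZ : derivZ (cprofilePotential V B Q i m s) x = derivZ (fun y => Q i m s y ^ 2) x +
      2 * ∑ l, ∑ n, derivZ (planePressure (B l n s • V l n) (Q l n s)) x := by
    simp only [derivZ, hd.fderiv, _root_.add_apply, FunLike.coe_smul, Pi.smul_apply, smul_eq_mul,
      _root_.sum_apply]
  rw [eR, eZ]
  have eRs : ∀ l n, derivR (planePressure (B l n s • V l n) (Q l n s)) x =
      derivR (planePressure 0 (Q l n s)) x - B l n s ^ 2 * (pressureInteraction (V l n) (Q l n s) x).1 :=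
    fun l n => (h1 l n).derivR_planePressure_smul (hB l n) x
  have eZs : ∀ l n, derivZ (planePressure (B l n s • V l n) (Q l n s)) x =
      derivZ (planePressure 0 (Q l n s)) x - B l n s ^ 2 * (pressureInteraction (V l n) (Q l n s) x).2 :=
    fun l n => (h1 l n).derivZ_planePressure_smul (hB l n) x
  have hSR : ∑ l, ∑ n, derivR (planePressure (B l n s • V l n) (Q l n s)) x =
      ∑ l, ∑ n, (derivR (planePressure 0 (Q l n s)) x -
        B l n s ^ 2 * (pressureInteraction (V l n) (Q l n s) x).1) :=
    Finset.sum_congr rfl fun l _ => Finset.sum_congr rfl fun n _ => eRs l n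
  have hSZ : ∑ l, ∑ n, derivZ (planePressure (B l n s • V l n) (Q l n s)) x =
      ∑ l, ∑ n, (derivZ (planePressure 0 (Q l n s)) x -
        B l n s ^ 2 * (pressureInteraction (V l n) (Q l n s) x).2) :=
    Finset.sum_congr rfl fun l _ => Finset.sum_congr rfl fun n _ => eZs l n
  rw [hSR, hSZ, sum_sum_comb]
  ring

/-- **The link (6.20) ↔ expanded form**: at time `s`,
`V_i^m·∇((H_i^m)² + 2Σ_{l,n} p[a_l^{n,k}V_l^n,H_l^n])(x) = g_i^m(s,x) + Σ_{l,n} a_l^{n,k}(s)² f_{i,l}^{m,n}(s,x)`.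
[cite: Ozanski2017NSISingular, §6.3 (6.20)] -/
theorem link (hQ : IsCantorQData U V f φ ψ H T δ κ a) (k : ℕ) (i : Fin 2) (m : A) (s : ℝ)
    (x : ℝ × ℝ) :
    (V i m x).1 * derivR (cprofilePotential V (a k) H i m s) x +
        (V i m x).2 * derivZ (cprofilePotential V (a k) H i m s) x =
      cgFam V H i m s x + ∑ l, ∑ n, a k l n s ^ 2 * cfFam V H i l m n s x := by
  rw [inner_grad_cprofilePotential (ψ := ψ) s (fun l n => (hQ.H_smooth l n).slice_param s)
    (fun l n b hb => hQ.H_str l n s b hb) (fun l n => hQ.osc.abs_le k l n s) i m x]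
  simp only [cgFam, cfFam]
  have e : ∀ l n, a k l n s ^ 2 * (-2 * ((V i m x).1 * (pressureInteraction (V l n) (H l n s) x).1 +
      (V i m x).2 * (pressureInteraction (V l n) (H l n s) x).2)) =
      (-2) * (a k l n s ^ 2 * ((V i m x).1 * (pressureInteraction (V l n) (H l n s) x).1 +
        (V i m x).2 * (pressureInteraction (V l n) (H l n s) x).2)) := fun l n => by ring
  simp only [e, sum_sum_mul, sum_sum_sub]
  ring

/-! ### Compactness constants -/

/-- **The margin `(H^m_{i,t})² ≥ |V_i^m|² + μ` on `[0,T] × {φ_i^m = 1}`**, one `μ > 0` for all pairs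
(`H > |V|` on `U`, compactness, finitely many pairs). [cite: Ozanski2017NSISingular, §6.3 Step 2 and §4.1 (4.19)] -/
theorem exists_margin (hQ : IsCantorQData U V f φ ψ H T δ κ a) :
    ∃ μ > 0, ∀ i m, ∀ t ∈ Icc (0 : ℝ) T, ∀ x, φ i m x = 1 →
      (V i m x).1 ^ 2 + (V i m x).2 ^ 2 + μ ≤ H i m t x ^ 2 := by
  have key : ∀ p : Fin 2 × A, ∃ μ > 0, ∀ t ∈ Icc (0 : ℝ) T, ∀ x, φ p.1 p.2 x = 1 →
      (V p.1 p.2 x).1 ^ 2 + (V p.1 p.2 x).2 ^ 2 + μ ≤ H p.1 p.2 t x ^ 2 := by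
    rintro ⟨i, m⟩
    have hS := hQ.isNSIStructure i m
    set K : Set (ℝ × (ℝ × ℝ)) := Icc (0 : ℝ) T ×ˢ {x | φ i m x = 1} with hK
    have hKc : IsCompact K := isCompact_Icc.prod (hS.isCompact_tsupport_φ.of_isClosed_subset
      (isClosed_eq hS.φ_smooth.continuous continuous_const) fun x hx => mem_tsupport_of_eq_one hx)
    set g : ℝ × (ℝ × ℝ) → ℝ := fun p =>
      H i m p.1 p.2 ^ 2 - ((V i m p.2).1 ^ 2 + (V i m p.2).2 ^ 2)
    have hv : Continuous fun p : ℝ × (ℝ × ℝ) => V i m p.2 :=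
      hS.v_smooth.continuous.comp continuous_snd
    have hgc : Continuous g := ((hQ.H_smooth i m).continuous.pow 2).sub
      (((continuous_fst.comp hv).pow 2).add ((continuous_snd.comp hv).pow 2))
    have hpos : ∀ p ∈ K, 0 < g p := by
      rintro ⟨t, x⟩ ⟨-, hx⟩
      have hxU : x ∈ U i m := hS.tsupport_φ (mem_tsupport_of_eq_one hx)
      have := (hQ.H_str_one i m t).sq_lt x hxU
      simp only [g]; linarith
    obtain ⟨μ, hμ, hle⟩ := IsQData.exists_forall_le_of_pos hKc hgc.continuousOn hpos
    refine ⟨μ, hμ, fun t ht x hx => ?_⟩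
    have := hle (t, x) ⟨ht, hx⟩
    simp only [g] at this; linarith
  obtain ⟨μ, hμ, h⟩ := exists_pos_forall_fintype key fun p θ θ' _ hle hP t ht x hx => by
    have := hP t ht x hx; linarith
  exact ⟨μ, hμ, fun i m => h (i, m)⟩

/-- A common bound `|V_i^m,₁| + |V_i^m,₂| ≤ B` for all planar fields. [folklore] -/
theorem exists_abs_V_le (hQ : IsCantorQData U V f φ ψ H T δ κ a) :
    ∃ B : ℝ, 0 ≤ B ∧ ∀ i m x, |(V i m x).1| + |(V i m x).2| ≤ B := by
  obtain ⟨B, hB, h⟩ := exists_nonneg_forall_fintype (ι := Fin 2 × A)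
    (P := fun p B => ∀ x, |(V p.1 p.2 x).1| + |(V p.1 p.2 x).2| ≤ B)
    (fun p => (hQ.isNSIStructure p.1 p.2).exists_abs_v_le) fun p B B' hle hP x => (hP x).trans hle
  exact ⟨B, hB, fun i m => h (i, m)⟩

/-- A common constant for the first lemma of Appendix A.3 on all `U_i^m`. [cite: Ozanski2017NSISingular, App. A.3 (first lemma)] -/
theorem exists_pressure_constant (U : Fin 2 → A → Set (ℝ × ℝ)) :
    ∃ K : ℝ, 0 ≤ K ∧ ∀ i m, ∀ (v : ℝ × ℝ → ℝ × ℝ) (g₁ g₂ φ₁ φ₂ : ℝ × ℝ → ℝ),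
      IsNSIStructure (U i m) v g₁ φ₁ → IsNSIStructure (U i m) v g₂ φ₂ → ∀ (S₁ S₂ : ℝ),
      (∀ q, ‖fderiv ℝ (fun q' => g₁ q' ^ 2 - g₂ q' ^ 2) q‖ ≤ S₁) →
      (∀ q, ‖fderiv ℝ (fderiv ℝ fun q' => g₁ q' ^ 2 - g₂ q' ^ 2) q‖ ≤ S₂) → ∀ q : ℝ × ℝ,
        |derivR (planePressure v g₁) q - derivR (planePressure v g₂) q| ≤ K * (S₁ + S₂) ∧
        |derivZ (planePressure v g₁) q - derivZ (planePressure v g₂) q| ≤ K * (S₁ + S₂) := by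
  have key : ∀ p : Fin 2 × A, ∃ K : ℝ, 0 ≤ K ∧ ∀ (v : ℝ × ℝ → ℝ × ℝ) (g₁ g₂ φ₁ φ₂ : ℝ × ℝ → ℝ),
      IsNSIStructure (U p.1 p.2) v g₁ φ₁ → IsNSIStructure (U p.1 p.2) v g₂ φ₂ → ∀ (S₁ S₂ : ℝ),
      (∀ q, ‖fderiv ℝ (fun q' => g₁ q' ^ 2 - g₂ q' ^ 2) q‖ ≤ S₁) →
      (∀ q, ‖fderiv ℝ (fderiv ℝ fun q' => g₁ q' ^ 2 - g₂ q' ^ 2) q‖ ≤ S₂) → ∀ q : ℝ × ℝ,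
        |derivR (planePressure v g₁) q - derivR (planePressure v g₂) q| ≤ K * (S₁ + S₂) ∧
        |derivZ (planePressure v g₁) q - derivZ (planePressure v g₂) q| ≤ K * (S₁ + S₂) :=
    fun p => exists_planePressure_sub_le (U p.1 p.2)
  obtain ⟨K, hK, h⟩ := exists_nonneg_forall_fintype key
    fun p K K' hle hP v g₁ g₂ φ₁ φ₂ hg₁ hg₂ S₁ S₂ hS₁ hS₂ q => by
      have hS0 : 0 ≤ S₁ + S₂ :=
        add_nonneg ((norm_nonneg _).trans (hS₁ q)) ((norm_nonneg _).trans (hS₂ q))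
      have := hP v g₁ g₂ φ₁ φ₂ hg₁ hg₂ S₁ S₂ hS₁ hS₂ q
      exact ⟨this.1.trans (mul_le_mul_of_nonneg_right hle hS0),
        this.2.trans (mul_le_mul_of_nonneg_right hle hS0)⟩
  exact ⟨K, hK, fun i m => h (i, m)⟩

/-! ### Uniform smallness for `k` large ((6.21)), on the whole plane -/

/-- **Goodness of an index `k` at tolerance `ε`**: the oscillatory error of (6.20) and all its
planar derivatives of order `≤ 2` are `≤ ε` on `[0,T] × ℝ²`, for all `(i, m)`.
[cite: Ozanski2017NSISingular, §6.3 (6.21)] -/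
def Good (a : ℕ → Fin 2 → A → ℝ → ℝ) (V : Fin 2 → A → ℝ × ℝ → ℝ × ℝ)
    (H : Fin 2 → A → ℝ → ℝ × ℝ → ℝ) (T : ℝ) (k : ℕ) (ε : ℝ) : Prop :=
  ∀ t ∈ Icc (0 : ℝ) T, ∀ x : ℝ × ℝ, ∀ (i : Fin 2) (m : A),
    |coscError a (cgFam V H) (cfFam V H) k i m t x| ≤ ε ∧
    |derivR (coscError a (cgFam V H) (cfFam V H) k i m t) x| ≤ ε ∧
    |derivZ (coscError a (cgFam V H) (cfFam V H) k i m t) x| ≤ ε ∧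
    |derivR (derivR (coscError a (cgFam V H) (cfFam V H) k i m t)) x| ≤ ε ∧
    |derivR (derivZ (coscError a (cgFam V H) (cfFam V H) k i m t)) x| ≤ ε ∧
    |derivZ (derivR (coscError a (cgFam V H) (cfFam V H) k i m t)) x| ≤ ε ∧
    |derivZ (derivZ (coscError a (cgFam V H) (cfFam V H) k i m t)) x| ≤ ε

/-- **(6.21) for the data: every tolerance is met for `k` large**, on the whole plane (on
`P = ⋃ Ū_i^m` by `IsCantorOscFamily.coscError_small_two`; off `P` the error vanishes identically
with its derivatives). [cite: Ozanski2017NSISingular, §6.3 (6.21) and §6.4 (6.27)] -/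
theorem exists_good (hQ : IsCantorQData U V f φ ψ H T δ κ a) {ε : ℝ} (hε : 0 < ε) :
    ∃ K : ℕ, ∀ k ≥ K, Good a V H T k ε := by
  obtain ⟨K, hK⟩ :=
    hQ.osc.coscError_small_two hQ.isCompact_P hQ.contDiff_cgFam hQ.contDiff_cfFam ε hε
  refine ⟨K, fun k hk t ht x i m => ?_⟩
  by_cases hx : x ∈ ⋃ i, ⋃ m, closure (U i m)
  · exact hK k hk x hx t ht i m
  · -- off `P` the error vanishes identically near `x`
    have hO : IsOpen (⋃ i, ⋃ m, closure (U i m))ᶜ :=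
      (isClosed_iUnion_of_finite fun i => isClosed_iUnion_of_finite fun m =>
        isClosed_closure).isOpen_compl
    have hE : ∀ x' ∈ (⋃ i, ⋃ m, closure (U i m))ᶜ,
        coscError a (cgFam V H) (cfFam V H) k i m t x' = 0 := fun x' hx' =>
      coscError_eq_zero (hQ.V_eq_zero_of_notMem_P hx' i m) k t
    obtain ⟨h1, h2, h3, h4, h5, h6⟩ := IsQData.derivs_eq_zero_of_eqOn hO hE hx
    rw [hE x hx, h1, h2, h3, h4, h5, h6, abs_zero]
    exact ⟨hε.le, hε.le, hε.le, hε.le, hε.le, hε.le, hε.le⟩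

/-! ### The radicand: smoothness, time derivative, sign -/

/-- The integrand of (6.20) is jointly smooth. [cite: Ozanski2017NSISingular, §6.3 (6.20)] -/
theorem contDiff_integrand (hQ : IsCantorQData U V f φ ψ H T δ κ a) (k : ℕ) (i : Fin 2) (m : A) :
    ContDiff ℝ ∞ (uncurry fun (s : ℝ) (x : ℝ × ℝ) => a k i m s *
      (cgFam V H i m s x + ∑ l, ∑ n, a k l n s ^ 2 * cfFam V H i l m n s x)) :=
  contDiff_coscIntegrand hQ.osc hQ.contDiff_cgFam hQ.contDiff_cfFam k i m

/-- **The radicand `(q^{m,k}_{i,t})²(x)` is jointly smooth in `(t,x)`.**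
[cite: Ozanski2017NSISingular, §6.3 Step 2] -/
theorem contDiff_cqRad (hQ : IsCantorQData U V f φ ψ H T δ κ a) (k : ℕ) (i : Fin 2) (m : A) :
    ContDiff ℝ ∞ (uncurry (cqRad f φ δ κ a V H k i m)) := by
  have hS := hQ.isNSIStructure i m
  have hI := contDiff_primitive_param (hQ.contDiff_integrand k i m)
  have h1 : ContDiff ℝ ∞ fun p : ℝ × (ℝ × ℝ) => f i m p.2 ^ 2 - 2 * κ p.1 * δ * φ i m p.2 :=
    ((hS.f_smooth.comp contDiff_snd).pow 2).sub
      (((contDiff_const.mul (hQ.κ_smooth.comp contDiff_fst)).mul contDiff_const).mul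
        (hS.φ_smooth.comp contDiff_snd))
  exact h1.sub hI

/-- **(6.20), differentiated:
`∂ₜ(q^{m,k}_{i,t})²(x) = -2δφ_i^m(x) - a_i^{m,k}(t)(g_i^m + Σ_{l,n}(a_l^{n,k})² f_{i,l}^{m,n})(t,x)`**
for `t ∈ [0,T]` (`κ' = 1` there). [cite: Ozanski2017NSISingular, §6.3 (after (6.20))] -/
theorem hasDerivAt_cqRad (hQ : IsCantorQData U V f φ ψ H T δ κ a) (k : ℕ) (i : Fin 2) (m : A)
    {t : ℝ} (ht : t ∈ Icc (0 : ℝ) T) (x : ℝ × ℝ) :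
    HasDerivAt (fun s => cqRad f φ δ κ a V H k i m s x)
      (-(2 * δ * φ i m x) - a k i m t *
        (cgFam V H i m t x + ∑ l, ∑ n, a k l n t ^ 2 * cfFam V H i l m n t x)) t := by
  have hκ : HasDerivAt κ 1 t := by
    have := (hQ.κ_smooth.differentiable (by simp) t).hasDerivAt
    rwa [hQ.deriv_κ_eq t ht] at this
  have h1 : HasDerivAt (fun s => f i m x ^ 2 - 2 * κ s * δ * φ i m x) (-(2 * δ * φ i m x)) t := by
    have h := ((hκ.const_mul 2).mul_const δ).mul_const (φ i m x)
    exact (h.const_sub (f i m x ^ 2)).congr_deriv (by ring)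
  have h2 := hasDerivAt_primitive_param (hQ.contDiff_integrand k i m) t x
  exact h1.sub h2

/-- **`(q^{m,k}_{i,t})² > |V_i^m|²` on `U_i^m` for `t ∈ [0,T]`** when `k` is good at a tolerance
`ε < μ`. [cite: Ozanski2017NSISingular, §6.3 Step 2 (structures for `k` large)] -/
theorem sq_lt_cqRad_of_mem_Icc (hQ : IsCantorQData U V f φ ψ H T δ κ a) {k : ℕ} {ε μ : ℝ}
    (hg : Good a V H T k ε)
    (hμ : ∀ i m, ∀ t ∈ Icc (0 : ℝ) T, ∀ x, φ i m x = 1 →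
      (V i m x).1 ^ 2 + (V i m x).2 ^ 2 + μ ≤ H i m t x ^ 2)
    (hεμ : ε < μ) (i : Fin 2) (m : A) {t : ℝ} (ht : t ∈ Icc (0 : ℝ) T) {x : ℝ × ℝ}
    (hx : x ∈ U i m) :
    (V i m x).1 ^ 2 + (V i m x).2 ^ 2 < cqRad f φ δ κ a V H k i m t x := by
  have hS := hQ.isNSIStructure i m
  rcases (hS.φ_mem x).2.lt_or_eq with hφ | hφ
  · rw [cqRad_of_V_eq_zero (hQ.V_eq_zero_of_lt hφ), hQ.V_eq_zero_of_lt hφ]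
    obtain ⟨μ', hμ', hgap⟩ := hQ.gap i m
    simpa using hS.radicand_pos_of_gap hμ' (hgap (κ t) (hQ.κ_mem t)) hx
  · have h1 := hQ.cqRad_sub_H_sq k i m (hQ.κ_eq t ht) x
    have h2 := (abs_le.1 (hg t ht x i m).1).2
    have h3 := hμ i m t ht x hφ
    linarith

/-- If `(q^{m,k}_{i,t})² > |V_i^m|²` on `U_i^m` then `(q^{m,k}_{i,t})² ≥ 0` everywhere. [folklore] -/
theorem cqRad_nonneg (hQ : IsCantorQData U V f φ ψ H T δ κ a) (k : ℕ) (i : Fin 2) (m : A) {t : ℝ}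
    (ht : ∀ x ∈ U i m, (V i m x).1 ^ 2 + (V i m x).2 ^ 2 < cqRad f φ δ κ a V H k i m t x)
    (x : ℝ × ℝ) : 0 ≤ cqRad f φ δ κ a V H k i m t x := by
  by_cases hx : x ∈ U i m
  · have := ht x hx; nlinarith [sq_nonneg (V i m x).1, sq_nonneg (V i m x).2]
  · have hS := hQ.isNSIStructure i m
    have hφ : x ∉ tsupport (φ i m) := fun h => hx (hS.tsupport_φ h)
    rw [cqRad_of_V_eq_zero (hQ.V_eq_zero_of_notMem hφ), image_eq_zero_of_notMem_tsupport hφ,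
      mul_zero, sub_zero]
    exact sq_nonneg _

/-- **"By continuity": `(q^{m,k}_{i,t})² > |V_i^m|²` on `U_i^m` for `t` in an open interval around
`[0,T]`**, one interval for all pairs (tube lemma per pair, finitely many pairs).
[cite: Ozanski2017NSISingular, §6.3 Step 2 ("for `t ∈ (-δ_k, T+δ_k)`")] -/
theorem exists_eta (hQ : IsCantorQData U V f φ ψ H T δ κ a) (k : ℕ)
    (hpos : ∀ i m, ∀ t ∈ Icc (0 : ℝ) T, ∀ x ∈ U i m,
      (V i m x).1 ^ 2 + (V i m x).2 ^ 2 < cqRad f φ δ κ a V H k i m t x) :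
    ∃ η > 0, ∀ i m, ∀ t ∈ Ioo (-η) (T + η), ∀ x ∈ U i m,
      (V i m x).1 ^ 2 + (V i m x).2 ^ 2 < cqRad f φ δ κ a V H k i m t x := by
  have key : ∀ p : Fin 2 × A, ∃ η > 0, ∀ t ∈ Ioo (-η) (T + η), ∀ x ∈ U p.1 p.2,
      (V p.1 p.2 x).1 ^ 2 + (V p.1 p.2 x).2 ^ 2 < cqRad f φ δ κ a V H k p.1 p.2 t x := by
    rintro ⟨i, m⟩
    have hS := hQ.isNSIStructure i m
    set O : Set (ℝ × (ℝ × ℝ)) :=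
      {p | (V i m p.2).1 ^ 2 + (V i m p.2).2 ^ 2 < cqRad f φ δ κ a V H k i m p.1 p.2} with hO
    have hv : Continuous fun p : ℝ × (ℝ × ℝ) => V i m p.2 :=
      hS.v_smooth.continuous.comp continuous_snd
    have hOo : IsOpen O := isOpen_lt (((continuous_fst.comp hv).pow 2).add
      ((continuous_snd.comp hv).pow 2)) (hQ.contDiff_cqRad k i m).continuous
    have hsub : Icc (0 : ℝ) T ×ˢ tsupport (φ i m) ⊆ O := by
      rintro ⟨t, x⟩ ⟨ht, hx⟩
      exact hpos i m t ht x (hS.tsupport_φ hx)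
    obtain ⟨u, w, hu, -, hIu, hKw, huw⟩ :=
      generalized_tube_lemma isCompact_Icc hS.isCompact_tsupport_φ hOo hsub
    obtain ⟨η, hη, hηu⟩ := IsQData.exists_Ioo_subset hu hQ.T_pos.le hIu
    refine ⟨η, hη, fun t ht x hx => ?_⟩
    by_cases hxφ : x ∈ tsupport (φ i m)
    · have hmem := huw (mk_mem_prod (hηu ht) (hKw hxφ))
      exact hmem
    · rw [cqRad_of_V_eq_zero (hQ.V_eq_zero_of_notMem hxφ), hQ.V_eq_zero_of_notMem hxφ,
        image_eq_zero_of_notMem_tsupport hxφ, mul_zero, sub_zero]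
      simpa using pow_pos (hS.f_pos hx) 2
  obtain ⟨η, hη, h⟩ := exists_pos_forall_fintype key fun p θ θ' _ hle hP t ht x hx =>
    hP t ⟨by linarith [ht.1], by linarith [ht.2]⟩ x hx
  exact ⟨η, hη, fun i m => h (i, m)⟩

/-! ### The profile `q^{m,k}`: values, smoothness, squares -/

/-- `q^{m,k}_{i,t} ≥ 0`. [cite: Ozanski2017NSISingular, §6.3 (6.20)] -/
theorem cqProf_nonneg (k : ℕ) (i : Fin 2) (m : A) (t : ℝ) (x : ℝ × ℝ) :
    0 ≤ cqProf f φ δ κ a V H k i m t x :=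
  Real.sqrt_nonneg _

/-- **`q^{m,k}_{i,0} = f_i^m`** (giving `|v^{(j)}(x,0)| = h₀^{(j)}(R⁻¹x)`, Prop. 16 (ii)).
[cite: Ozanski2017NSISingular, Prop. 16 (ii) and §6.3 Step 3] -/
theorem cqProf_zero (hQ : IsCantorQData U V f φ ψ H T δ κ a) (k : ℕ) (i : Fin 2) (m : A)
    (x : ℝ × ℝ) : cqProf f φ δ κ a V H k i m 0 x = f i m x := by
  have h0 : κ 0 = 0 := hQ.κ_eq 0 ⟨le_rfl, hQ.T_pos.le⟩
  rw [cqProf, cqRad, h0, coscIntegral, intervalIntegral.integral_same]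
  simp [Real.sqrt_sq ((hQ.isNSIStructure i m).f_nonneg x)]

/-- **`q^{m,k}_{i,t} = 0` off `Ū_i^m`** (all data vanish there). [cite: Ozanski2017NSISingular, Prop. 16 (i)] -/
theorem cqProf_eq_zero (hQ : IsCantorQData U V f φ ψ H T δ κ a) (k : ℕ) (i : Fin 2) (m : A) (t : ℝ)
    {x : ℝ × ℝ} (hx : x ∉ closure (U i m)) : cqProf f φ δ κ a V H k i m t x = 0 := by
  have hS := hQ.isNSIStructure i m
  have hφ : x ∉ tsupport (φ i m) := fun h => hx (subset_closure (hS.tsupport_φ h))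
  rw [cqProf, cqRad_of_V_eq_zero (hQ.V_eq_zero_of_notMem hφ), image_eq_zero_of_notMem_tsupport hφ,
    hS.f_eq_zero hx]
  simp

/-- **On `{φ_i^m < 1}`, `q^{m,k}_{i,t}` is the damped profile `√((f_i^m)² - 2κ(t)δφ_i^m)`** (`V_i^m = 0`
there). [cite: Ozanski2017NSISingular, §6.3 Step 2] -/
theorem cqProf_eq_dampedProfile (hQ : IsCantorQData U V f φ ψ H T δ κ a) (k : ℕ) (i : Fin 2)
    (m : A) (t : ℝ) {x : ℝ × ℝ} (hx : φ i m x < 1) :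
    cqProf f φ δ κ a V H k i m t x = dampedProfile (f i m) (φ i m) δ (κ t) x := by
  rw [cqProf, cqRad_of_V_eq_zero (hQ.V_eq_zero_of_lt hx), dampedProfile_apply]

/-- **On `{φ_i^m < 1}`, `q^{m,k}_{i,t} = h^m_{i,t}`** (both are the damped profile there).
[cite: Ozanski2017NSISingular, §6.3 Step 2] -/
theorem cqProf_eq_H (hQ : IsCantorQData U V f φ ψ H T δ κ a) (k : ℕ) (i : Fin 2) (m : A) (t : ℝ)
    {x : ℝ × ℝ} (hx : φ i m x < 1) : cqProf f φ δ κ a V H k i m t x = H i m t x := by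
  rw [hQ.cqProf_eq_dampedProfile k i m t hx, hQ.H_eq_dampedProfile i m t hx]

/-- `q^{m,k}_{i,t} = f_i^m` off `supp φ_i^m`. [cite: Ozanski2017NSISingular, §6.3 Step 2] -/
theorem cqProf_eq_of_notMem (hQ : IsCantorQData U V f φ ψ H T δ κ a) (k : ℕ) (i : Fin 2) (m : A)
    (t : ℝ) {x : ℝ × ℝ} (hx : x ∉ tsupport (φ i m)) : cqProf f φ δ κ a V H k i m t x = f i m x := by
  rw [hQ.cqProf_eq_dampedProfile k i m t (by rw [image_eq_zero_of_notMem_tsupport hx]; norm_num),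
    (hQ.isNSIStructure i m).dampedProfile_eq_of_notMem δ _ hx]

/-- **`q^{m,k}_i` is jointly smooth on `S × ℝ²`** whenever `(q^{m,k}_{i,t})² > |V_i^m|²` on `U_i^m` for
`t ∈ S`, `S` open. [cite: Ozanski2017NSISingular, §6.3 Step 2 ("`q_i^{𝔪,k} ∈ C^∞`")] -/
theorem contDiffOn_cqProf (hQ : IsCantorQData U V f φ ψ H T δ κ a) (k : ℕ) (i : Fin 2) (m : A)
    {S : Set ℝ}
    (hpos : ∀ t ∈ S, ∀ x ∈ U i m, (V i m x).1 ^ 2 + (V i m x).2 ^ 2 < cqRad f φ δ κ a V H k i m t x) :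
    ContDiffOn ℝ ∞ (uncurry (cqProf f φ δ κ a V H k i m)) (S ×ˢ (univ : Set (ℝ × ℝ))) := by
  have hSi := hQ.isNSIStructure i m
  rintro ⟨t, x⟩ ⟨ht, -⟩
  by_cases hx : x ∈ tsupport (φ i m)
  · have hp : 0 < cqRad f φ δ κ a V H k i m t x := by
      have := hpos t ht x (hSi.tsupport_φ hx)
      nlinarith [sq_nonneg (V i m x).1, sq_nonneg (V i m x).2]
    have hp' : uncurry (cqRad f φ δ κ a V H k i m) (t, x) ≠ 0 := hp.ne'
    exact ((hQ.contDiff_cqRad k i m).contDiffAt.sqrt hp').contDiffWithinAt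
  · have hO : IsOpen ((univ : Set ℝ) ×ˢ (tsupport (φ i m))ᶜ) :=
      isOpen_univ.prod (isClosed_tsupport _).isOpen_compl
    have hev : uncurry (cqProf f φ δ κ a V H k i m) =ᶠ[𝓝 (t, x)] fun p : ℝ × (ℝ × ℝ) => f i m p.2 :=
      Filter.eventually_of_mem (hO.mem_nhds ⟨mem_univ _, hx⟩) fun p hp =>
        hQ.cqProf_eq_of_notMem k i m p.1 hp.2
    exact ((hSi.f_smooth.comp contDiff_snd).contDiffAt.congr_of_eventuallyEq hev).contDiffWithinAt

omit [Fintype A] in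
/-- `(q^{m,k}_{i,t})² = cqRad` wherever the radicand is nonnegative. [folklore] -/
theorem cqProf_sq [Fintype A] {k : ℕ} {i : Fin 2} {m : A} {t : ℝ} {x : ℝ × ℝ}
    (h : 0 ≤ cqRad f φ δ κ a V H k i m t x) :
    cqProf f φ δ κ a V H k i m t x ^ 2 = cqRad f φ δ κ a V H k i m t x := by
  rw [cqProf, Real.sq_sqrt h]

/-- **`(bV_i^m, q^{m,k}_{i,t}, ψ_i^m)` is a structure on `U_i^m`** for `|b| ≤ 1`, and
`L(q^{m,k}_{i,t}) ≥ 0` on `{φ_i^m < 1/4}`, by the perturbation criterion.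
[cite: Ozanski2017NSISingular, §6.3 Step 2 (structures for `k` large)] -/
theorem crit_cqProf (hQ : IsCantorQData U V f φ ψ H T δ κ a) {k : ℕ} (i : Fin 2) (m : A)
    {S : Set ℝ}
    (hposS : ∀ t ∈ S, ∀ x ∈ U i m, (V i m x).1 ^ 2 + (V i m x).2 ^ 2 < cqRad f φ δ κ a V H k i m t x)
    {t : ℝ} (ht : t ∈ S) (htT : κ t ∈ Icc (-1 : ℝ) (T + 1)) :
    (∀ b : ℝ, |b| ≤ 1 → IsNSIStructure (U i m) (b • V i m) (cqProf f φ δ κ a V H k i m t) (ψ i m)) ∧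
      (∀ x, φ i m x < 1 / 4 → 0 ≤ opL (cqProf f φ δ κ a V H k i m t) x) ∧
      (∀ x ∈ tsupport (φ i m), φ i m x ≤ 1 / 4 → 0 < opL (cqProf f φ δ κ a V H k i m t) x) ∧
      (∀ x ∈ U i m, 0 < cqProf f φ δ κ a V H k i m t x) ∧
      (∀ x ∉ closure (U i m), cqProf f φ δ κ a V H k i m t x = 0) ∧
      (∀ x ∉ tsupport (φ i m), cqProf f φ δ κ a V H k i m t x = f i m x) :=
  hQ.crit i m (κ t) htT _
    (IsSmoothSpaceTimeOn.contDiff_slice (w := cqProf f φ δ κ a V H k i m)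
      (hQ.contDiffOn_cqProf k i m hposS) ht)
    (cqProf_nonneg k i m t) (fun _ hx => hQ.cqProf_eq_dampedProfile k i m t hx) fun x hx => by
      rw [cqProf_sq (hQ.cqRad_nonneg k i m (hposS t ht) x)]
      exact hposS t ht x ((hQ.isNSIStructure i m).tsupport_φ (mem_tsupport_of_eq_one hx))

/-! ### The first lemma of Appendix A.3 applied to `(w, q^{n,k}_{l,t})`, `(w, h^n_{l,t})` ((6.25)) -/

/-- **`(q^{n,k}_{l,t})² - (h^n_{l,t})² = -coscError` as functions of `x`**, for `t ∈ [0,T]` with the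
radicand nonnegative. [cite: Ozanski2017NSISingular, §6.3 (6.20)] -/
theorem cqProf_sq_sub_H_sq (hQ : IsCantorQData U V f φ ψ H T δ κ a) (k : ℕ) (l : Fin 2) (n : A)
    {t : ℝ} (ht : t ∈ Icc (0 : ℝ) T)
    (hpos : ∀ x ∈ U l n, (V l n x).1 ^ 2 + (V l n x).2 ^ 2 < cqRad f φ δ κ a V H k l n t x) :
    (fun y => cqProf f φ δ κ a V H k l n t y ^ 2 - H l n t y ^ 2) =
      -(coscError a (cgFam V H) (cfFam V H) k l n t) := by
  funext y
  rw [cqProf_sq (hQ.cqRad_nonneg k l n hpos y), Pi.neg_apply, ← hQ.cqRad_sub_H_sq k l n (hQ.κ_eq t ht) y]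

/-- **The `C⁰/C¹/C²` sizes `ε`, `2ε`, `4ε` of `(q^{n,k}_{l,t})² - (h^n_{l,t})²`** for a good `k`
((6.21) fed into the continuity lemma). [cite: Ozanski2017NSISingular, §6.3 (6.21)–(6.22), (6.25)] -/
theorem norm_fderiv_sq_sub_le (hQ : IsCantorQData U V f φ ψ H T δ κ a) {k : ℕ} {ε : ℝ}
    (hg : Good a V H T k ε) (l : Fin 2) (n : A) {t : ℝ} (ht : t ∈ Icc (0 : ℝ) T)
    (hpos : ∀ x ∈ U l n, (V l n x).1 ^ 2 + (V l n x).2 ^ 2 < cqRad f φ δ κ a V H k l n t x) :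
    (∀ y, |cqProf f φ δ κ a V H k l n t y ^ 2 - H l n t y ^ 2| ≤ ε) ∧
    (∀ y, ‖fderiv ℝ (fun y' => cqProf f φ δ κ a V H k l n t y' ^ 2 - H l n t y' ^ 2) y‖ ≤ 2 * ε) ∧
      ∀ y, ‖fderiv ℝ (fderiv ℝ fun y' => cqProf f φ δ κ a V H k l n t y' ^ 2 - H l n t y' ^ 2) y‖ ≤
        4 * ε := by
  set E := coscError a (cgFam V H) (cfFam V H) k l n t with hE
  have e := hQ.cqProf_sq_sub_H_sq k l n ht hpos
  have hD : fderiv ℝ (-E) = -fderiv ℝ E := by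
    funext y; exact fderiv_neg
  have hE2 : ContDiff ℝ 2 E :=
    contDiff_infty.1 (contDiff_coscError hQ.osc hQ.contDiff_cgFam hQ.contDiff_cfFam k l n t) 2
  refine ⟨fun y => ?_, fun y => ?_, fun y => ?_⟩
  · have h1 := congrFun e y
    simp only [Pi.neg_apply] at h1
    rw [h1, abs_neg]
    exact (hg t ht y l n).1
  · rw [e, hD, Pi.neg_apply, norm_neg]
    have h := norm_fderiv_le_abs_add E y
    have h1 := (hg t ht y l n).2.1
    have h2 := (hg t ht y l n).2.2.1
    linarith
  · rw [e, hD]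
    have : fderiv ℝ (-fderiv ℝ E) y = -fderiv ℝ (fderiv ℝ E) y := fderiv_neg
    rw [this, norm_neg]
    have h := norm_fderiv_fderiv_le hE2 y
    obtain ⟨-, -, -, h3, h4, h5, h6⟩ := hg t ht y l n
    linarith

/-- **`|∇p[w, q^{n,k}_{l,t}] - ∇p[w, h^n_{l,t}]| ≤ 6Kε`** componentwise, for `w ∈ {V_l^n, 0}` (the first
lemma of Appendix A.3 with `S₁ + S₂ = 6ε`; Ożański (6.25): "for sufficiently large `k`", "see
Lemma A.… for a verification that (6.21) is sufficient").
[cite: Ozanski2017NSISingular, §6.3 (6.25) and App. A.3 (first lemma)] -/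
theorem abs_grad_planePressure_sub_le (hQ : IsCantorQData U V f φ ψ H T δ κ a) {k : ℕ} {ε : ℝ}
    (hg : Good a V H T k ε) {K : ℝ}
    (hK : ∀ i m, ∀ (v : ℝ × ℝ → ℝ × ℝ) (g₁ g₂ φ₁ φ₂ : ℝ × ℝ → ℝ),
      IsNSIStructure (U i m) v g₁ φ₁ → IsNSIStructure (U i m) v g₂ φ₂ → ∀ (S₁ S₂ : ℝ),
      (∀ q, ‖fderiv ℝ (fun q' => g₁ q' ^ 2 - g₂ q' ^ 2) q‖ ≤ S₁) →
      (∀ q, ‖fderiv ℝ (fderiv ℝ fun q' => g₁ q' ^ 2 - g₂ q' ^ 2) q‖ ≤ S₂) → ∀ q : ℝ × ℝ,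
        |derivR (planePressure v g₁) q - derivR (planePressure v g₂) q| ≤ K * (S₁ + S₂) ∧
        |derivZ (planePressure v g₁) q - derivZ (planePressure v g₂) q| ≤ K * (S₁ + S₂))
    (l : Fin 2) (n : A) {t : ℝ} (ht : t ∈ Icc (0 : ℝ) T)
    (hpos : ∀ x ∈ U l n, (V l n x).1 ^ 2 + (V l n x).2 ^ 2 < cqRad f φ δ κ a V H k l n t x)
    {w : ℝ × ℝ → ℝ × ℝ} {χ₁ χ₂ : ℝ × ℝ → ℝ}
    (h1 : IsNSIStructure (U l n) w (cqProf f φ δ κ a V H k l n t) χ₁)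
    (h2 : IsNSIStructure (U l n) w (H l n t) χ₂) (x : ℝ × ℝ) :
    |derivR (planePressure w (cqProf f φ δ κ a V H k l n t)) x - derivR (planePressure w (H l n t)) x| ≤
        K * (6 * ε) ∧
      |derivZ (planePressure w (cqProf f φ δ κ a V H k l n t)) x - derivZ (planePressure w (H l n t)) x| ≤
        K * (6 * ε) := by
  obtain ⟨-, hS₁, hS₂⟩ := hQ.norm_fderiv_sq_sub_le hg l n ht hpos
  have := hK l n w _ _ χ₁ χ₂ h1 h2 (2 * ε) (4 * ε) hS₁ hS₂ x
  have e : K * (2 * ε + 4 * ε) = K * (6 * ε) := by ring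
  rw [e] at this
  exact this

/-! ### The inner inequality on `C_i^m` (Case 2 of Step 3) -/

/-- The absolute value of a double sum over a finite type is at most `2·card A` times a uniform
bound of the summands. [folklore] -/
theorem abs_sum_sum_le {g : Fin 2 → A → ℝ} {c : ℝ} (h : ∀ l n, |g l n| ≤ c) :
    |∑ l, ∑ n, g l n| ≤ 2 * (Fintype.card A) * c := by
  calc |∑ l, ∑ n, g l n| ≤ ∑ l, |∑ n, g l n| := Finset.abs_sum_le_sum_abs _ _
    _ ≤ ∑ l, ∑ n, |g l n| := Finset.sum_le_sum fun l _ => Finset.abs_sum_le_sum_abs _ _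
    _ ≤ ∑ _l : Fin 2, ∑ _n : A, c := Finset.sum_le_sum fun l _ => Finset.sum_le_sum fun n _ => h l n
    _ = 2 * (Fintype.card A) * c := by
      simp only [Finset.sum_const, Finset.card_univ, Fintype.card_fin, nsmul_eq_mul, Nat.cast_ofNat]
      ring

/-- **The transport error `|v_i^m·∇(Ψ^q - Ψ^h)| ≤ B(1 + 72·card A·K)ε` at good `k`** ((6.25): the
difference of the planar potentials built on `q` and on `h` is `C¹`-small; `2·card A` pressure
terms). [cite: Ozanski2017NSISingular, §6.3 (6.25)] -/
theorem abs_inner_error_le (hQ : IsCantorQData U V f φ ψ H T δ κ a) {k : ℕ} {ε : ℝ}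
    (hg : Good a V H T k ε) (hε : 0 ≤ ε) {K : ℝ} (hK0 : 0 ≤ K)
    (hK : ∀ i m, ∀ (v : ℝ × ℝ → ℝ × ℝ) (g₁ g₂ φ₁ φ₂ : ℝ × ℝ → ℝ),
      IsNSIStructure (U i m) v g₁ φ₁ → IsNSIStructure (U i m) v g₂ φ₂ → ∀ (S₁ S₂ : ℝ),
      (∀ q, ‖fderiv ℝ (fun q' => g₁ q' ^ 2 - g₂ q' ^ 2) q‖ ≤ S₁) →
      (∀ q, ‖fderiv ℝ (fderiv ℝ fun q' => g₁ q' ^ 2 - g₂ q' ^ 2) q‖ ≤ S₂) → ∀ q : ℝ × ℝ,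
        |derivR (planePressure v g₁) q - derivR (planePressure v g₂) q| ≤ K * (S₁ + S₂) ∧
        |derivZ (planePressure v g₁) q - derivZ (planePressure v g₂) q| ≤ K * (S₁ + S₂))
    {B : ℝ} (hB : ∀ i m x, |(V i m x).1| + |(V i m x).2| ≤ B) {S : Set ℝ}
    (hposS : ∀ i m, ∀ t ∈ S, ∀ x ∈ U i m,
      (V i m x).1 ^ 2 + (V i m x).2 ^ 2 < cqRad f φ δ κ a V H k i m t x)
    (i : Fin 2) (m : A) {t : ℝ} (htS : t ∈ S) (ht : t ∈ Icc (0 : ℝ) T) (x : ℝ × ℝ) :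
    |((V i m x).1 * derivR (cprofilePotential V (a k) (cqProf f φ δ κ a V H k) i m t) x +
        (V i m x).2 * derivZ (cprofilePotential V (a k) (cqProf f φ δ κ a V H k) i m t) x) -
      ((V i m x).1 * derivR (cprofilePotential V (a k) H i m t) x +
        (V i m x).2 * derivZ (cprofilePotential V (a k) H i m t) x)| ≤
      B * (1 + 72 * (Fintype.card A) * K) * ε := by
  have hκt : κ t ∈ Icc (-1 : ℝ) (T + 1) := by
    rw [hQ.κ_eq t ht]; exact ⟨by linarith [ht.1], by linarith [ht.2]⟩
  -- structures at time `t`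
  have hcrit := fun l n => hQ.crit_cqProf (k := k) l n (hposS l n) htS hκt
  have hQstr : ∀ l n, ∀ b : ℝ, |b| ≤ 1 →
      IsNSIStructure (U l n) (b • V l n) (cqProf f φ δ κ a V H k l n t) (ψ l n) := fun l n =>
    (hcrit l n).1
  have hQ1 : ∀ l n, IsNSIStructure (U l n) (V l n) (cqProf f φ δ κ a V H k l n t) (ψ l n) :=
    fun l n => by simpa using hQstr l n 1 (by norm_num)
  have hQ0 : ∀ l n, IsNSIStructure (U l n) 0 (cqProf f φ δ κ a V H k l n t) (ψ l n) :=
    fun l n => by simpa using hQstr l n 0 (by norm_num)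
  have hposT : ∀ l n, ∀ x ∈ U l n, (V l n x).1 ^ 2 + (V l n x).2 ^ 2 < cqRad f φ δ κ a V H k l n t x :=
    fun l n => hposS l n t htS
  -- the two expansions
  have eQ := inner_grad_cprofilePotential (U := U) (ψ := ψ)
    (Q := cqProf f φ δ κ a V H k) (B := a k) t (fun l n => (hQ1 l n).f_smooth) hQstr
    (fun l n => hQ.osc.abs_le k l n t) i m x
  have eH := inner_grad_cprofilePotential (U := U) (ψ := ψ) (Q := H) (B := a k) t
    (fun l n => (hQ.H_smooth l n).slice_param t) (fun l n b hb => hQ.H_str l n t b hb)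
    (fun l n => hQ.osc.abs_le k l n t) i m x
  -- abbreviations
  set w1 := (V i m x).1 with hw1
  set w2 := (V i m x).2 with hw2
  set Dq := w1 * derivR (fun y => cqProf f φ δ κ a V H k i m t y ^ 2) x +
    w2 * derivZ (fun y => cqProf f φ δ κ a V H k i m t y ^ 2) x with hDq
  set DH := w1 * derivR (fun y => H i m t y ^ 2) x + w2 * derivZ (fun y => H i m t y ^ 2) x with hDH
  set Sq : Fin 2 → A → ℝ := fun l n =>
    (w1 * derivR (planePressure 0 (cqProf f φ δ κ a V H k l n t)) x +
        w2 * derivZ (planePressure 0 (cqProf f φ δ κ a V H k l n t)) x) -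
      a k l n t ^ 2 * (w1 * (pressureInteraction (V l n) (cqProf f φ δ κ a V H k l n t) x).1 +
        w2 * (pressureInteraction (V l n) (cqProf f φ δ κ a V H k l n t) x).2) with hSq
  set SH : Fin 2 → A → ℝ := fun l n =>
    (w1 * derivR (planePressure 0 (H l n t)) x + w2 * derivZ (planePressure 0 (H l n t)) x) -
      a k l n t ^ 2 * (w1 * (pressureInteraction (V l n) (H l n t) x).1 +
        w2 * (pressureInteraction (V l n) (H l n t) x).2) with hSH
  have ediff : (Dq + 2 * ∑ l, ∑ n, Sq l n) - (DH + 2 * ∑ l, ∑ n, SH l n) =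
      (Dq - DH) + 2 * ∑ l, ∑ n, (Sq l n - SH l n) := by
    simp only [Finset.sum_sub_distrib]; ring
  rw [eQ, eH]
  change |(Dq + 2 * ∑ l, ∑ n, Sq l n) - (DH + 2 * ∑ l, ∑ n, SH l n)| ≤ _
  rw [ediff]
  -- the atomic differences and their bounds
  have hd1 : DifferentiableAt ℝ (fun y => cqProf f φ δ κ a V H k i m t y ^ 2) x :=
    (((hQ1 i m).f_smooth.pow 2).differentiable (by simp)) x
  have hd2 : DifferentiableAt ℝ (fun y => H i m t y ^ 2) x :=
    ((((hQ.H_smooth i m).slice_param t).pow 2).differentiable (by simp)) x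
  have hsub : fderiv ℝ (fun y => cqProf f φ δ κ a V H k i m t y ^ 2 - H i m t y ^ 2) x =
      fderiv ℝ (fun y => cqProf f φ δ κ a V H k i m t y ^ 2) x - fderiv ℝ (fun y => H i m t y ^ 2) x :=
    (hd1.hasFDerivAt.sub hd2.hasFDerivAt).fderiv
  have esub := hQ.cqProf_sq_sub_H_sq k i m ht (hposT i m)
  have hnegR : ∀ e : ℝ × ℝ, fderiv ℝ (-coscError a (cgFam V H) (cfFam V H) k i m t) x e =
      -(fderiv ℝ (coscError a (cgFam V H) (cfFam V H) k i m t) x e) := fun e => by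
    rw [fderiv_neg]; rfl
  have hDR : |derivR (fun y => cqProf f φ δ κ a V H k i m t y ^ 2) x -
      derivR (fun y => H i m t y ^ 2) x| ≤ ε := by
    have e : derivR (fun y => cqProf f φ δ κ a V H k i m t y ^ 2) x - derivR (fun y => H i m t y ^ 2) x =
        derivR (fun y => cqProf f φ δ κ a V H k i m t y ^ 2 - H i m t y ^ 2) x := by
      simp only [derivR, hsub]; rfl
    rw [e, esub, derivR, hnegR, abs_neg]
    exact (hg t ht x i m).2.1
  have hDZ : |derivZ (fun y => cqProf f φ δ κ a V H k i m t y ^ 2) x -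
      derivZ (fun y => H i m t y ^ 2) x| ≤ ε := by
    have e : derivZ (fun y => cqProf f φ δ κ a V H k i m t y ^ 2) x - derivZ (fun y => H i m t y ^ 2) x =
        derivZ (fun y => cqProf f φ δ κ a V H k i m t y ^ 2 - H i m t y ^ 2) x := by
      simp only [derivZ, hsub]; rfl
    rw [e, esub, derivZ, hnegR, abs_neg]
    exact (hg t ht x i m).2.2.1
  have hv : |w1| + |w2| ≤ B := hB i m x
  have hvB : 0 ≤ B := le_trans (add_nonneg (abs_nonneg _) (abs_nonneg _)) hv
  have hD : |Dq - DH| ≤ B * ε := by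
    have e : Dq - DH = w1 * (derivR (fun y => cqProf f φ δ κ a V H k i m t y ^ 2) x -
        derivR (fun y => H i m t y ^ 2) x) +
        w2 * (derivZ (fun y => cqProf f φ δ κ a V H k i m t y ^ 2) x -
          derivZ (fun y => H i m t y ^ 2) x) := by
      simp only [hDq, hDH]; ring
    rw [e]
    exact (IsQData.abs_comb_le hDR hDZ).trans (mul_le_mul_of_nonneg_right hv hε)
  have hP0 := fun l n => hQ.abs_grad_planePressure_sub_le hg hK l n ht (hposT l n) (hQ0 l n)
    (hQ.H_str_zero l n t) x
  have hP1 := fun l n => hQ.abs_grad_planePressure_sub_le hg hK l n ht (hposT l n) (hQ1 l n)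
    (hQ.H_str_one l n t) x
  -- `F = ∇p[0,·] - ∇p[V_l,·]`: differences of `F` are controlled by both
  have hF : ∀ l n, |(pressureInteraction (V l n) (cqProf f φ δ κ a V H k l n t) x).1 -
        (pressureInteraction (V l n) (H l n t) x).1| ≤ K * (6 * ε) + K * (6 * ε) ∧
      |(pressureInteraction (V l n) (cqProf f φ δ κ a V H k l n t) x).2 -
        (pressureInteraction (V l n) (H l n t) x).2| ≤ K * (6 * ε) + K * (6 * ε) := by
    intro l n
    simp only [pressureInteraction]
    constructor
    · calc |derivR (planePressure 0 (cqProf f φ δ κ a V H k l n t)) x -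
              derivR (planePressure (V l n) (cqProf f φ δ κ a V H k l n t)) x -
            (derivR (planePressure 0 (H l n t)) x - derivR (planePressure (V l n) (H l n t)) x)|
          = |(derivR (planePressure 0 (cqProf f φ δ κ a V H k l n t)) x -
                derivR (planePressure 0 (H l n t)) x) -
              (derivR (planePressure (V l n) (cqProf f φ δ κ a V H k l n t)) x -
                derivR (planePressure (V l n) (H l n t)) x)| := by ring_nf
        _ ≤ _ := abs_sub _ _
        _ ≤ K * (6 * ε) + K * (6 * ε) := add_le_add (hP0 l n).1 (hP1 l n).1
    · calc |derivZ (planePressure 0 (cqProf f φ δ κ a V H k l n t)) x -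
              derivZ (planePressure (V l n) (cqProf f φ δ κ a V H k l n t)) x -
            (derivZ (planePressure 0 (H l n t)) x - derivZ (planePressure (V l n) (H l n t)) x)|
          = |(derivZ (planePressure 0 (cqProf f φ δ κ a V H k l n t)) x -
                derivZ (planePressure 0 (H l n t)) x) -
              (derivZ (planePressure (V l n) (cqProf f φ δ κ a V H k l n t)) x -
                derivZ (planePressure (V l n) (H l n t)) x)| := by ring_nf
        _ ≤ _ := abs_sub _ _
        _ ≤ K * (6 * ε) + K * (6 * ε) := add_le_add (hP0 l n).2 (hP1 l n).2
  have ha2 : ∀ l n, a k l n t ^ 2 ≤ 1 := fun l n => hQ.osc.sq_le k l n t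
  -- each summand is `≤ 18 B K ε`
  have hS : ∀ l n, |Sq l n - SH l n| ≤ B * (18 * K * ε) := by
    intro l n
    have e : Sq l n - SH l n =
        (w1 * (derivR (planePressure 0 (cqProf f φ δ κ a V H k l n t)) x -
            derivR (planePressure 0 (H l n t)) x) +
          w2 * (derivZ (planePressure 0 (cqProf f φ δ κ a V H k l n t)) x -
            derivZ (planePressure 0 (H l n t)) x)) -
        (w1 * (a k l n t ^ 2 * ((pressureInteraction (V l n) (cqProf f φ δ κ a V H k l n t) x).1 -
            (pressureInteraction (V l n) (H l n t) x).1)) +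
          w2 * (a k l n t ^ 2 * ((pressureInteraction (V l n) (cqProf f φ δ κ a V H k l n t) x).2 -
            (pressureInteraction (V l n) (H l n t) x).2))) := by
      simp only [hSq, hSH]; ring
    rw [e]
    have b1 := IsQData.abs_comb_le (v1 := w1) (v2 := w2) (hP0 l n).1 (hP0 l n).2
    have b2 := IsQData.abs_comb_le (v1 := w1) (v2 := w2)
      (IsQData.abs_sq_mul_le (ha2 l n) (hF l n).1) (IsQData.abs_sq_mul_le (ha2 l n) (hF l n).2)
    calc _ ≤ (|w1| + |w2|) * (K * (6 * ε)) + (|w1| + |w2|) * (K * (6 * ε) + K * (6 * ε)) :=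
          (abs_sub _ _).trans (add_le_add b1 b2)
      _ = (|w1| + |w2|) * (18 * K * ε) := by ring
      _ ≤ B * (18 * K * ε) := mul_le_mul_of_nonneg_right hv (by positivity)
  have hsum := abs_sum_sum_le hS
  -- assemble
  calc |(Dq - DH) + 2 * ∑ l, ∑ n, (Sq l n - SH l n)|
      ≤ |Dq - DH| + |2 * ∑ l, ∑ n, (Sq l n - SH l n)| := abs_add_le _ _
    _ = |Dq - DH| + 2 * |∑ l, ∑ n, (Sq l n - SH l n)| := by rw [abs_mul, abs_two]
    _ ≤ B * ε + 2 * (2 * (Fintype.card A) * (B * (18 * K * ε))) := by gcongr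
    _ = B * (1 + 72 * (Fintype.card A) * K) * ε := by ring

/-- **The time derivative of `(q^{m,k}_{i,·})²(x)` at `t ∈ [0,T]`** equals that of the radicand, the
radicand being nonnegative for times near `t`. [cite: Ozanski2017NSISingular, §6.3 (after (6.20))] -/
theorem deriv_cqProf_sq (hQ : IsCantorQData U V f φ ψ H T δ κ a) {k : ℕ} {η : ℝ}
    (hposS : ∀ i m, ∀ t ∈ Ioo (-η) (T + η), ∀ x ∈ U i m,
      (V i m x).1 ^ 2 + (V i m x).2 ^ 2 < cqRad f φ δ κ a V H k i m t x)
    (hηI : Icc (0 : ℝ) T ⊆ Ioo (-η) (T + η))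
    (i : Fin 2) (m : A) {t : ℝ} (ht : t ∈ Icc (0 : ℝ) T) (x : ℝ × ℝ) :
    deriv (fun s => cqProf f φ δ κ a V H k i m s x ^ 2) t =
      -(2 * δ * φ i m x) - a k i m t *
        (cgFam V H i m t x + ∑ l, ∑ n, a k l n t ^ 2 * cfFam V H i l m n t x) := by
  have hmem : Ioo (-η) (T + η) ∈ 𝓝 t := isOpen_Ioo.mem_nhds (hηI ht)
  have hev : (fun s => cqProf f φ δ κ a V H k i m s x ^ 2) =ᶠ[𝓝 t]
      fun s => cqRad f φ δ κ a V H k i m s x :=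
    Filter.eventually_of_mem hmem fun s hs => cqProf_sq (hQ.cqRad_nonneg k i m (hposS i m s hs) x)
  rw [hev.deriv_eq, (hQ.hasDerivAt_cqRad k i m ht x).deriv]

/-- **The inner inequality on `C_i^m = {φ_i^m ≥ 1/4}` with slack `δ/4`** (Ożański §6.3 Step 3, Case 2:
`∂ₜ(q^{𝔪,k}_i)² = -2δφ_i^𝔪 - a_i^{𝔪,k}v_i^𝔪·∇Ψ^h ≤ -δ/2 + |v·∇(Ψ^q - Ψ^h)| - a v·∇Ψ^q`, and (6.25)
makes the error `≤ δ/4`; Scheffer 1987, (3.24)).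
[cite: Ozanski2017NSISingular, §6.3 Step 3 (Case 2, (6.25))] [cite: Scheffer1987, Lemma 3.2 (3.24)] -/
theorem inner_ineq (hQ : IsCantorQData U V f φ ψ H T δ κ a) {k : ℕ} {ε : ℝ} (hg : Good a V H T k ε)
    (hε : 0 ≤ ε) {K : ℝ} (hK0 : 0 ≤ K)
    (hK : ∀ i m, ∀ (v : ℝ × ℝ → ℝ × ℝ) (g₁ g₂ φ₁ φ₂ : ℝ × ℝ → ℝ),
      IsNSIStructure (U i m) v g₁ φ₁ → IsNSIStructure (U i m) v g₂ φ₂ → ∀ (S₁ S₂ : ℝ),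
      (∀ q, ‖fderiv ℝ (fun q' => g₁ q' ^ 2 - g₂ q' ^ 2) q‖ ≤ S₁) →
      (∀ q, ‖fderiv ℝ (fderiv ℝ fun q' => g₁ q' ^ 2 - g₂ q' ^ 2) q‖ ≤ S₂) → ∀ q : ℝ × ℝ,
        |derivR (planePressure v g₁) q - derivR (planePressure v g₂) q| ≤ K * (S₁ + S₂) ∧
        |derivZ (planePressure v g₁) q - derivZ (planePressure v g₂) q| ≤ K * (S₁ + S₂))
    {B : ℝ} (hB : ∀ i m x, |(V i m x).1| + |(V i m x).2| ≤ B)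
    (hεδ : B * (1 + 72 * (Fintype.card A) * K) * ε ≤ δ / 4) {η : ℝ}
    (hposS : ∀ i m, ∀ t ∈ Ioo (-η) (T + η), ∀ x ∈ U i m,
      (V i m x).1 ^ 2 + (V i m x).2 ^ 2 < cqRad f φ δ κ a V H k i m t x)
    (hηI : Icc (0 : ℝ) T ⊆ Ioo (-η) (T + η))
    (i : Fin 2) (m : A) {t : ℝ} (ht : t ∈ Icc (0 : ℝ) T) {x : ℝ × ℝ} (hx : 1 / 4 ≤ φ i m x) :
    deriv (fun s => cqProf f φ δ κ a V H k i m s x ^ 2) t ≤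
      -(δ / 4) - (a k i m t * (V i m x).1 *
            derivR (cprofilePotential V (a k) (cqProf f φ δ κ a V H k) i m t) x +
        a k i m t * (V i m x).2 *
            derivZ (cprofilePotential V (a k) (cqProf f φ δ κ a V H k) i m t) x) := by
  have htS : t ∈ Ioo (-η) (T + η) := hηI ht
  rw [hQ.deriv_cqProf_sq hposS hηI i m ht x, ← hQ.link k i m t x]
  have herr := hQ.abs_inner_error_le hg hε hK0 hK hB hposS i m htS ht x
  set PQ := (V i m x).1 * derivR (cprofilePotential V (a k) (cqProf f φ δ κ a V H k) i m t) x +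
    (V i m x).2 * derivZ (cprofilePotential V (a k) (cqProf f φ δ κ a V H k) i m t) x with hPQ
  set PH := (V i m x).1 * derivR (cprofilePotential V (a k) H i m t) x +
    (V i m x).2 * derivZ (cprofilePotential V (a k) H i m t) x with hPH
  have hE : |PQ - PH| ≤ δ / 4 := herr.trans hεδ
  have ha : |a k i m t| ≤ 1 := hQ.osc.abs_le k i m t
  have h1 : |a k i m t * (PQ - PH)| ≤ δ / 4 := by
    rw [abs_mul]
    calc |a k i m t| * |PQ - PH| ≤ 1 * (δ / 4) := mul_le_mul ha hE (abs_nonneg _) zero_le_one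
      _ = δ / 4 := one_mul _
  have h2 := (abs_le.1 h1).2
  have hδ := hQ.δ_pos
  have hφ : δ / 2 ≤ 2 * δ * φ i m x := by nlinarith
  have e : a k i m t * (V i m x).1 *
        derivR (cprofilePotential V (a k) (cqProf f φ δ κ a V H k) i m t) x +
      a k i m t * (V i m x).2 *
        derivZ (cprofilePotential V (a k) (cqProf f φ δ κ a V H k) i m t) x = a k i m t * PQ := by
    simp only [hPQ]; ring
  rw [e]
  have h3 : a k i m t * (PQ - PH) = a k i m t * PQ - a k i m t * PH := by ring
  linarith

/-! ### Off `C_i^m` (Case 1 of Step 3) -/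

/-- **Off `C_i^m`: `∂ₜ(q^{m,k}_{i,t})²(x) = -2δφ_i^m(x) ≤ 0`** (`v_i^m(x) = 0` for `φ_i^m(x) < 1`).
[cite: Ozanski2017NSISingular, §6.3 Step 3 (Case 1)] -/
theorem outer_deriv (hQ : IsCantorQData U V f φ ψ H T δ κ a) {k : ℕ} {η : ℝ}
    (hposS : ∀ i m, ∀ t ∈ Ioo (-η) (T + η), ∀ x ∈ U i m,
      (V i m x).1 ^ 2 + (V i m x).2 ^ 2 < cqRad f φ δ κ a V H k i m t x)
    (hηI : Icc (0 : ℝ) T ⊆ Ioo (-η) (T + η))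
    (i : Fin 2) (m : A) {t : ℝ} (ht : t ∈ Icc (0 : ℝ) T) {x : ℝ × ℝ} (hx : φ i m x < 1) :
    deriv (fun s => cqProf f φ δ κ a V H k i m s x ^ 2) t ≤ 0 := by
  have hV := hQ.V_eq_zero_of_lt hx
  rw [hQ.deriv_cqProf_sq hposS hηI i m ht x, cgFam_eq_zero hV]
  simp only [cfFam_eq_zero _ _ hV, mul_zero, Finset.sum_const_zero, add_zero, sub_zero]
  have := (hQ.isNSIStructure i m).φ_mem x
  nlinarith [hQ.δ_pos, this.1]

/-! ### Assembly: profile data from the input of Steps 1–2 -/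

/-- The tolerance `ε > 0` with `ε < μ`, `4ε ≤ ε₀` and `B(1 + 72·card A·K)ε ≤ δ/4`. [folklore] -/
theorem exists_tolerance {μ ε₀ δ B K N : ℝ} (hμ : 0 < μ) (hε₀ : 0 < ε₀) (hδ : 0 < δ) (hB : 0 ≤ B)
    (hK : 0 ≤ K) (hN : 0 ≤ N) :
    ∃ ε : ℝ, 0 < ε ∧ ε < μ ∧ 4 * ε ≤ ε₀ ∧ B * (1 + 72 * N * K) * ε ≤ δ / 4 := by
  set W : ℝ := B * (1 + 72 * N * K) + 1 with hW
  have hBN : 0 ≤ B * (1 + 72 * N * K) := by positivity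
  have hW1 : 1 ≤ W := by simp only [hW]; linarith
  have hWpos : 0 < W := by linarith
  refine ⟨min (min (μ / 2) (ε₀ / 4)) (δ / (4 * W)),
    lt_min (lt_min (by positivity) (by positivity)) (by positivity),
    lt_of_le_of_lt ((min_le_left _ _).trans (min_le_left _ _)) (by linarith), ?_, ?_⟩
  · have : min (min (μ / 2) (ε₀ / 4)) (δ / (4 * W)) ≤ ε₀ / 4 :=
      (min_le_left _ _).trans (min_le_right _ _)
    linarith
  · have h1 : min (min (μ / 2) (ε₀ / 4)) (δ / (4 * W)) ≤ δ / (4 * W) := min_le_right _ _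
    have h2 : B * (1 + 72 * N * K) ≤ W := by simp only [hW]; linarith
    calc B * (1 + 72 * N * K) * min (min (μ / 2) (ε₀ / 4)) (δ / (4 * W)) ≤ W * (δ / (4 * W)) :=
          mul_le_mul h2 h1 (le_min (le_min (by positivity) (by positivity)) (by positivity)) hWpos.le
      _ = δ / 4 := by field_simp

/-- **Proposition 16, the data: the input of Steps 1–2 yields profile data for the composite
field** in the sense of `IsNSICantorProfileData` — margin `η` from the tube lemma, slack `δ/4`,
closed sets `C_i^m = {φ_i^m ≥ 1/4}`, directions `a_i^{m,k}` and profiles `q^{m,k}_i` for a good `k`,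
at any prescribed `C²`-tolerance `ε₀ > 0` (Ożański: "(6.23) is a solution to Proposition 16 (given
the oscillatory processes) … for `k` large enough"; Scheffer 1987, Lemma 3.2).
[cite: Ozanski2017NSISingular, §6.3 Steps 2–3] [cite: Scheffer1987, Lemma 3.2] -/
theorem exists_cantorProfileData (hQ : IsCantorQData U V f φ ψ H T δ κ a) {ε₀ : ℝ} (hε₀ : 0 < ε₀) :
    ∃ (η : ℝ) (k : ℕ),
      IsNSICantorProfileData U V f φ H T η (δ / 4) ε₀ (fun i m => {x | 1 / 4 ≤ φ i m x}) (a k)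
        (cqProf f φ δ κ a V H k) := by
  obtain ⟨μ, hμ, hμle⟩ := hQ.exists_margin
  obtain ⟨B, hB0, hB⟩ := hQ.exists_abs_V_le
  obtain ⟨K, hK0, hK⟩ := exists_pressure_constant U
  have hδ := hQ.δ_pos
  obtain ⟨ε, hεpos, hεμ, hεε₀, hεδ⟩ :=
    exists_tolerance (N := (Fintype.card A : ℝ)) hμ hε₀ hδ hB0 hK0 (Nat.cast_nonneg _)
  obtain ⟨Kk, hKk⟩ := hQ.exists_good hεpos
  have hg : Good a V H T Kk ε := hKk Kk le_rfl
  have hposT : ∀ i m, ∀ t ∈ Icc (0 : ℝ) T, ∀ x ∈ U i m,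
      (V i m x).1 ^ 2 + (V i m x).2 ^ 2 < cqRad f φ δ κ a V H Kk i m t x :=
    fun i m t ht x hx => hQ.sq_lt_cqRad_of_mem_Icc hg hμle hεμ i m ht hx
  obtain ⟨η, hη, hposS⟩ := hQ.exists_eta Kk hposT
  have hηI : Icc (0 : ℝ) T ⊆ Ioo (-η) (T + η) := fun t ht => ⟨by linarith [ht.1], by linarith [ht.2]⟩
  have hκI : ∀ t ∈ Icc (0 : ℝ) T, κ t ∈ Icc (-1 : ℝ) (T + 1) := fun t ht => by
    rw [hQ.κ_eq t ht]; exact ⟨by linarith [ht.1], by linarith [ht.2]⟩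
  have hS := hQ.isNSIStructure
  refine ⟨η, Kk, ?_⟩
  exact
    { η_pos := hη
      δ_pos := by positivity
      B_smooth := fun i m => hQ.osc.contDiff Kk i m
      abs_B_le := fun i m t => hQ.osc.abs_le Kk i m t
      isClosed := fun i m => isClosed_le continuous_const (hS i m).φ_smooth.continuous
      subset := fun i m => (hS i m).setOf_le_φ_subset
      tsupport_V := fun i m x hx => by
        have h1 : φ i m x = 1 := (hS i m).tsupport_v hx
        show (1 : ℝ) / 4 ≤ φ i m x
        rw [h1]; norm_num
      Q_smooth := fun i m => hQ.contDiffOn_cqProf Kk i m (hposS i m)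
      Q_nonneg := fun i m t _ x => cqProf_nonneg Kk i m t x
      Q_eq_zero := fun i m t _ x hx => hQ.cqProf_eq_zero Kk i m t hx
      sq_lt := fun i m t ht x hx => by
        rw [cqProf_sq (hQ.cqRad_nonneg Kk i m (hposS i m t ht) x)]
        exact hposS i m t ht x hx
      initial := fun i m x => hQ.cqProf_zero Kk i m x
      eq_H := fun i m t x hx => hQ.cqProf_eq_H Kk i m t hx
      inner := fun i m t ht x hx => hQ.inner_ineq hg hεpos.le hK0 hK hB hεδ hposS hηI i m ht hx
      outer := fun i m t ht x hx =>
        hQ.outer_deriv hposS hηI i m ht (lt_of_lt_of_le (not_le.1 hx) (by norm_num))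
      opL := fun i m t ht x hx _ => mul_nonneg (cqProf_nonneg Kk i m t x)
        ((hQ.crit_cqProf i m (hposS i m) (hηI ht) (hκI t ht)).2.1 x (not_le.1 hx))
      ε_nonneg := hε₀.le
      close₀ := fun i m t ht x =>
        ((hQ.norm_fderiv_sq_sub_le hg i m ht (hposT i m t ht)).1 x).trans (by linarith)
      close₁ := fun i m t ht x =>
        ((hQ.norm_fderiv_sq_sub_le hg i m ht (hposT i m t ht)).2.1 x).trans (by linarith)
      close₂ := fun i m t ht x =>
        ((hQ.norm_fderiv_sq_sub_le hg i m ht (hposT i m t ht)).2.2 x).trans hεε₀ }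

end IsCantorQData

end Literature.Barriers.NavierStokesRegularity
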